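import Literature.Analysis.FunctionSpaces.CircleLogSobolev
import Mathlib.Analysis.Convex.Integral
import Mathlib.Analysis.Convex.Deriv
import Mathlib.Analysis.SpecialFunctions.Log.Deriv
import Mathlib.Analysis.SpecialFunctions.Log.NegMulLog
import Mathlib.Analysis.Calculus.MeanValue
import Mathlib.Analysis.Normed.Group.Tannery
import Mathlib.MeasureTheory.Function.ConvergenceInMeasure
import Mathlib.MeasureTheory.Function.L2Space
import Mathlib.MeasureTheory.Integral.DominatedConvergence
import HarnessLib

/-!
# Proof of Weissler's logarithmic Sobolev inequality on the circle

This file discharges the named fact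
`Literature.Analysis.FunctionSpaces.Weissler1980_circle_logSobolev` of
`Literature/Analysis/FunctionSpaces/CircleLogSobolev.lean` ([Weissler1980], J. Funct. Anal. 37,
§1 Thm 1, inequality (1.1)): for `f ≥ 0` in `L²(dθ/2π)` with Fourier coefficients `aₙ` and
`∑ₙ |n| |aₙ|² < ∞`,

  `∫ f² log f ≤ ∑ₙ |n| |aₙ|² + ‖f‖₂² log ‖f‖₂`.

## The printed proof and the proof formalised here

Weissler proves (1.1) in two steps (§1, pp. 220–224):

* (i) for a strictly positive trigonometric polynomial `f` with `a₀ = 1` the function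
  `G(r) = ∑ |n| r^{2|n|} |aₙ|² + ‖P_r f‖₂² log ‖P_r f‖₂ - ∫ (P_r f)² log P_r f` (`P_r` the Poisson
  kernel) is analytic near `[0,1]` and all its Taylor coefficients at `r = 0` are non-negative
  (multinomial expansion (1.4)–(1.7) and a monotone one-variable function `α`), whence
  `G(1) ≥ 0`; homogeneity removes `a₀ = 1`;
* (ii) a general `f` is approximated by the positive trigonometric polynomials `Q_k * f`
  (an approximate identity), the right-hand side converges and Fatou's lemma handles the left.

Step (ii) is formalised as printed (with the Fejér kernel as the approximate identity; second
part of this file). For step (i) we do NOT transcribe the power-series argument; instead the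
inequality for a non-negative trigonometric polynomial `g = a₀ + 2 Re ∑_{k=1}^K a_k e_k` with
`‖g‖₂ = 1` is obtained from two elementary facts (a genuinely shorter road, recorded here
because we did not find it in print):

* (J) **Jensen's inequality** for the convex function `Ψ(x) = x³/3 + x²/2 - x² log x` on
  `[0, ∞)` (`Ψ'' = 2 (x - 1 - log x) ≥ 0`) and the probability measure `dθ/2π`:
  `Ψ(a₀) = Ψ(∫ g) ≤ ∫ Ψ(g)`, i.e. `∫ g² log g ≤ ∫ g³/3 + 1/2 - Ψ(a₀)`;
* (C) the **moment identities** `∫ g² = a₀² + 2 M₀`, `∫ g³ = a₀³ + 6 a₀ M₀ + 6 Re T` with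
  `M₀ = ∑ |a_k|²`, `M₁ = ∑ k |a_k|²`, `T = ∑_{i,j ≥ 1, i+j ≤ K} a_i a_j conj(a_{i+j})`, and the
  coefficient inequality `|T| ≤ M₀ √(M₁ - M₀)` (one Cauchy–Schwarz over pairs `(i,j)`, using
  `∑_{i,j ≥ 1, i+j ≤ K} |a_{i+j}|² = ∑_m (m-1) |a_m|²`), which together with
  `2 M₀ √(M₁ - M₀) ≤ 2 (M₁ - M₀) + M₀²/2` and the one-variable inequality
  `a² log a + (2a-1)(1-a²)/2 + (1-a²)²/8 ≤ 0` on `[0,1]` (from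
  `log a ≤ (a-1) - (a-1)²/2 + (a-1)³/3`) gives
  `a₀² log a₀ + 2 a₀ M₀ + M₀ + 2 Re T ≤ 2 M₁ = ∑ₙ |n| |ĝₙ|²` whenever `a₀² + 2 M₀ = 1`.

Combining, `∫ g² log g ≤ ∑ₙ |n| |ĝₙ|²` for `‖g‖₂ = 1`, and the general case by homogeneity.
(The inequality is sharp to second order at `g = 1 + ε cos θ`, as is (1.1).)

## Contents

* `CircleLogSobolev.trigSum` — finite trigonometric sums on `AddCircle T`, products,
  conjugates, integrals against the normalised Haar measure;
* `CircleLogSobolev.realTrigPoly K a₀ a = a₀ + 2 Re ∑_{k=1}^K a_k e_k` and its first three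
  moments; `CircleLogSobolev.cubicCoeffSum`;
* the scalar and coefficient inequalities; convexity of `Ψ` (`CircleLogSobolev.jensenAux`);
* `CircleLogSobolev.logSobolev_realTrigPoly` — (1.1) for non-negative trigonometric
  polynomials;
* `CircleLogSobolev.fejerKernel`, `CircleLogSobolev.fejerMean_eq_realTrigPoly` — the Fejér means
  `σ_N f = f * F_N ≥ 0` of `f ≥ 0` are the trigonometric polynomials with coefficients
  `(1 - |n|/(N+1)) f̂(n)` (Katznelson, Ch. I §2.5);
* `CircleLogSobolev.integral_sq_eq_tsum_of_real` (Parseval, folded over `n ↦ -n`),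
  `CircleLogSobolev.tendsto_sqNorm_fejer` (`‖σ_N f‖₂ → ‖f‖₂`),
  `CircleLogSobolev.tendsto_integral_sq_fejerPoly_sub` (`‖σ_N f - f‖₂ → 0`, Tannery's theorem);
* `Weissler1980_circle_logSobolev_holds` — the discharge: (1.1) for `σ_N f`, an a.e. convergent
  subsequence, Fatou for `(x² log x)⁺` and dominated convergence for the bounded `(x² log x)⁻`.

## References

* [Weissler1980] F. B. Weissler, *Logarithmic Sobolev inequalities and hypercontractive
  estimates on the circle*, J. Funct. Anal. 37 (1980) 218–234, §1 Thm 1.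
* [Katznelson2004] Y. Katznelson, *An introduction to harmonic analysis*, 3rd ed., CUP 2004,
  Ch. I §2.5 (Fejér's kernel).
-/

open MeasureTheory Finset Complex AddCircle
open scoped ComplexConjugate

noncomputable section

namespace Literature.Analysis.FunctionSpaces

namespace CircleLogSobolev

/-! ## 1. Scalar and coefficient inequalities -/

section Scalar

/-- Cubic Taylor upper bound for the logarithm on `(0,1]`:
`log a ≤ (a-1) - (a-1)²/2 + (a-1)³/3` (the alternating series of `log (1 - δ)` has negative
terms only). [folklore] -/
theorem log_le_taylor_three {a : ℝ} (ha : 0 < a) (ha1 : a ≤ 1) :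
    Real.log a ≤ (a - 1) - (a - 1) ^ 2 / 2 + (a - 1) ^ 3 / 3 := by
  set h : ℝ → ℝ := fun x => (x - 1) - (x - 1) ^ 2 / 2 + (x - 1) ^ 3 / 3 - Real.log x with hh
  have hderiv : ∀ x, 0 < x → HasDerivAt h ((x - 1) ^ 3 / x) x := by
    intro x hx
    have h1 : HasDerivAt (fun x : ℝ => (x - 1) - (x - 1) ^ 2 / 2 + (x - 1) ^ 3 / 3)
        (1 - (x - 1) + (x - 1) ^ 2) x := by
      have hs : HasDerivAt (fun x : ℝ => x - 1) 1 x := (hasDerivAt_id x).sub_const 1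
      have h2 := (hs.pow 2).div_const 2
      have h3 := (hs.pow 3).div_const 3
      refine ((hs.sub h2).add h3).congr_deriv ?_
      norm_num
    have h2 : HasDerivAt Real.log x⁻¹ x := Real.hasDerivAt_log hx.ne'
    refine (h1.sub h2).congr_deriv ?_
    field_simp
    ring
  have hanti : AntitoneOn h (Set.Icc a 1) := by
    apply antitoneOn_of_deriv_nonpos (convex_Icc a 1)
    · intro x hx
      exact (hderiv x (lt_of_lt_of_le ha hx.1)).continuousAt.continuousWithinAt
    · intro x hx
      rw [interior_Icc] at hx
      exact (hderiv x (ha.trans hx.1)).differentiableAt.differentiableWithinAt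
    · intro x hx
      rw [interior_Icc] at hx
      rw [(hderiv x (ha.trans hx.1)).deriv]
      apply div_nonpos_of_nonpos_of_nonneg _ (ha.trans hx.1).le
      have : x - 1 ≤ 0 := by linarith [hx.2]
      nlinarith [this, sq_nonneg (x - 1)]
  have key : h 1 ≤ h a := hanti ⟨le_refl a, ha1⟩ ⟨ha1, le_refl 1⟩ ha1
  simp only [hh, Real.log_one, sub_self] at key
  norm_num at key
  linarith

/-- The one-variable inequality `a² log a + (2a-1)(1-a²)/2 + (1-a²)²/8 ≤ 0` on `[0,1]`:
after `log_le_taylor_three` the left side is at most `(a-1)² (8a³-17a²+6a-9)/24 ≤ 0`.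
[folklore] -/
theorem sq_mul_log_add_le_zero {a : ℝ} (ha : 0 ≤ a) (ha1 : a ≤ 1) :
    a ^ 2 * Real.log a + (2 * a - 1) * (1 - a ^ 2) / 2 + (1 - a ^ 2) ^ 2 / 8 ≤ 0 := by
  rcases ha.eq_or_lt with rfl | ha'
  · norm_num
  have hlog := log_le_taylor_three ha' ha1
  have h1 : a ^ 2 * Real.log a ≤ a ^ 2 * ((a - 1) - (a - 1) ^ 2 / 2 + (a - 1) ^ 3 / 3) :=
    mul_le_mul_of_nonneg_left hlog (sq_nonneg a)
  have hcubic : 8 * a ^ 3 - 17 * a ^ 2 + 6 * a - 9 < 0 := by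
    nlinarith [sq_nonneg (3 * a - 1), sq_nonneg a, ha', ha1]
  have hpoly : a ^ 2 * ((a - 1) - (a - 1) ^ 2 / 2 + (a - 1) ^ 3 / 3)
      + (2 * a - 1) * (1 - a ^ 2) / 2 + (1 - a ^ 2) ^ 2 / 8
      = (a - 1) ^ 2 * (8 * a ^ 3 - 17 * a ^ 2 + 6 * a - 9) / 24 := by ring
  have : (a - 1) ^ 2 * (8 * a ^ 3 - 17 * a ^ 2 + 6 * a - 9) / 24 ≤ 0 := by
    apply div_nonpos_of_nonpos_of_nonneg _ (by norm_num)
    exact mul_nonpos_of_nonneg_of_nonpos (sq_nonneg _) hcubic.le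
  linarith

/-- Pair regrouping: `∑_{i,j ∈ [1,K], i+j ≤ K} b (i+j) = ∑_{m ∈ [1,K]} (m-1) b m` (the fibre of
`m` under `(i,j) ↦ i+j` has `m-1` points). [folklore] -/
theorem sum_sum_ite_add_le_eq (b : ℕ → ℝ) (K : ℕ) :
    ∑ i ∈ Icc 1 K, ∑ j ∈ Icc 1 K, (if i + j ≤ K then b (i + j) else 0)
      = ∑ m ∈ Icc 1 K, ((m : ℝ) - 1) * b m := by
  have h1 : ∀ i ∈ Icc 1 K, (∑ j ∈ Icc 1 K, (if i + j ≤ K then b (i + j) else 0))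
      = ∑ m ∈ Icc (i + 1) K, b m := by
    intro i hi
    rw [Finset.mem_Icc] at hi
    rw [← sum_filter]
    have hf : (Icc 1 K).filter (fun j => i + j ≤ K) = Icc 1 (K - i) := by
      ext j
      simp only [mem_filter, Finset.mem_Icc]
      omega
    rw [hf]
    have hmap : (Icc 1 (K - i)).map (addLeftEmbedding i) = Icc (i + 1) K := by
      rw [map_add_left_Icc]
      congr 1
      omega
    rw [← hmap, sum_map]
    rfl
  rw [sum_congr rfl h1]
  rw [sum_comm' (s' := fun m => Icc 1 (m - 1)) (t' := Icc 1 K)]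
  · apply sum_congr rfl
    intro m hm
    rw [Finset.mem_Icc] at hm
    rw [sum_const, Nat.card_Icc, nsmul_eq_mul]
    congr 1
    have : m - 1 + 1 - 1 = m - 1 := by omega
    rw [this, Nat.cast_sub hm.1, Nat.cast_one]
  · intro i m
    simp only [Finset.mem_Icc]
    omega

/-- The cubic coefficient sum `T = ∑_{i,j ∈ [1,K], i+j ≤ K} a_i a_j conj(a_{i+j})`; its real part
is `(1/6) ∫ (2 Re p)³` for `p = ∑_{k=1}^K a_k e_k` (`integral_realTrigPoly_cube`). [folklore] -/
def cubicCoeffSum (K : ℕ) (a : ℕ → ℂ) : ℂ :=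
  ∑ i ∈ Icc 1 K, ∑ j ∈ Icc 1 K, a i * a j * (if i + j ≤ K then conj (a (i + j)) else 0)

/-- **Coefficient inequality** `|T| ≤ M₀ √(M₁ - M₀)` with `M₀ = ∑ |a_k|²`, `M₁ = ∑ k |a_k|²`:
one Cauchy–Schwarz over pairs `(i,j)`, the second factor being
`∑_{i,j ≥ 1, i+j ≤ K} |a_{i+j}|² = ∑_m (m-1)|a_m|² = M₁ - M₀` (`sum_sum_ite_add_le_eq`). [folklore] -/
theorem norm_cubicCoeffSum_le (K : ℕ) (a : ℕ → ℂ) :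
    ‖cubicCoeffSum K a‖
      ≤ (∑ k ∈ Icc 1 K, ‖a k‖ ^ 2)
        * Real.sqrt ((∑ k ∈ Icc 1 K, (k : ℝ) * ‖a k‖ ^ 2) - ∑ k ∈ Icc 1 K, ‖a k‖ ^ 2) := by
  set M0 : ℝ := ∑ k ∈ Icc 1 K, ‖a k‖ ^ 2 with hM0
  set M1 : ℝ := ∑ k ∈ Icc 1 K, (k : ℝ) * ‖a k‖ ^ 2 with hM1
  set u : ℕ × ℕ → ℝ := fun x => ‖a x.1‖ * ‖a x.2‖ with hu
  set v : ℕ × ℕ → ℝ := fun x => if x.1 + x.2 ≤ K then ‖a (x.1 + x.2)‖ else 0 with hv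
  have hM0nn : 0 ≤ M0 := sum_nonneg fun k _ => sq_nonneg _
  have htri : ‖cubicCoeffSum K a‖ ≤ ∑ x ∈ Icc 1 K ×ˢ Icc 1 K, u x * v x := by
    unfold cubicCoeffSum
    rw [sum_product' (f := fun i j => u (i, j) * v (i, j))]
    refine (norm_sum_le _ _).trans (sum_le_sum fun i _ => ?_)
    refine (norm_sum_le _ _).trans (sum_le_sum fun j _ => ?_)
    rw [norm_mul, norm_mul]
    simp only [hu, hv]
    split_ifs with h
    · rw [Complex.norm_conj]
    · simp
  have hCS := sum_mul_sq_le_sq_mul_sq (Icc 1 K ×ˢ Icc 1 K) u v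
  have hu2 : ∑ x ∈ Icc 1 K ×ˢ Icc 1 K, u x ^ 2 = M0 * M0 := by
    rw [hM0, sum_mul_sum, sum_product]
    refine sum_congr rfl fun i _ => sum_congr rfl fun j _ => ?_
    simp only [hu]; ring
  have hv2 : ∑ x ∈ Icc 1 K ×ˢ Icc 1 K, v x ^ 2 = M1 - M0 := by
    have := sum_sum_ite_add_le_eq (fun m => ‖a m‖ ^ 2) K
    rw [sum_product]
    have h2 : ∀ i ∈ Icc 1 K, ∑ j ∈ Icc 1 K, v (i, j) ^ 2
        = ∑ j ∈ Icc 1 K, (if i + j ≤ K then ‖a (i + j)‖ ^ 2 else 0) := by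
      intro i _
      refine sum_congr rfl fun j _ => ?_
      simp only [hv]
      split_ifs <;> simp
    rw [sum_congr rfl h2, this, hM1, hM0, ← sum_sub_distrib]
    refine sum_congr rfl fun m _ => ?_
    ring
  rw [hu2, hv2] at hCS
  have hnn : 0 ≤ ∑ x ∈ Icc 1 K ×ˢ Icc 1 K, u x * v x := by
    refine sum_nonneg fun x _ => mul_nonneg (mul_nonneg (norm_nonneg _) (norm_nonneg _)) ?_
    simp only [hv]; split_ifs <;> simp
  have : ∑ x ∈ Icc 1 K ×ˢ Icc 1 K, u x * v x ≤ M0 * Real.sqrt (M1 - M0) := by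
    have h := Real.abs_le_sqrt hCS
    rw [abs_of_nonneg hnn] at h
    rwa [show M0 * M0 * (M1 - M0) = (M0 ^ 2) * (M1 - M0) by ring, Real.sqrt_mul (sq_nonneg _),
      Real.sqrt_sq hM0nn] at h
  exact htri.trans this

/-- **The coefficient form of (1.1) for `‖g‖₂ = 1`.** If `a₀ ≥ 0`, `a₀² + 2M₀ = 1`, `M₀ ≤ M₁` and
`T ≤ M₀ √(M₁ - M₀)`, then `a₀² log a₀ + 2 a₀ M₀ + M₀ + 2 T ≤ 2 M₁` (AM–GM
`2 M₀ √(M₁-M₀) ≤ 2(M₁-M₀) + M₀²/2` and `sq_mul_log_add_le_zero` with `M₀ = (1-a₀²)/2`).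
[folklore] -/
theorem coeff_logSobolev_of_normalized {a0 M0 M1 T : ℝ} (ha0 : 0 ≤ a0) (hM0 : 0 ≤ M0)
    (hnorm : a0 ^ 2 + 2 * M0 = 1) (hM : M0 ≤ M1) (hT : T ≤ M0 * Real.sqrt (M1 - M0)) :
    a0 ^ 2 * Real.log a0 + 2 * a0 * M0 + M0 + 2 * T ≤ 2 * M1 := by
  have hD : 0 ≤ M1 - M0 := sub_nonneg.mpr hM
  have hsq : Real.sqrt (M1 - M0) ^ 2 = M1 - M0 := Real.sq_sqrt hD
  have hamgm : 2 * (M0 * Real.sqrt (M1 - M0)) ≤ 2 * (M1 - M0) + M0 ^ 2 / 2 := by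
    nlinarith [sq_nonneg (Real.sqrt (M1 - M0) - M0 / 2), hsq]
  have ha1 : a0 ≤ 1 := by nlinarith [sq_nonneg a0, sq_nonneg (a0 - 1)]
  have hM0' : M0 = (1 - a0 ^ 2) / 2 := by linarith
  have hs := sq_mul_log_add_le_zero ha0 ha1
  rw [hM0'] at hamgm hT ⊢
  nlinarith [hs, hT, hamgm]

end Scalar

/-! ## 2. Finite trigonometric sums on `AddCircle T` and their Haar integrals -/

section TrigSum

variable {T : ℝ} [hT : Fact (0 < T)]

/-- `∫ e_n d(θ/T) = [n = 0]` for the Fourier monomials of `AddCircle T` (Mathlib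
`fourierCoeff_fourier` at the index `0`). [folklore] -/
theorem integral_fourier_haar (n : ℤ) :
    ∫ x : AddCircle T, fourier n x ∂haarAddCircle = if n = 0 then 1 else 0 := by
  have h := congrFun (fourierCoeff_fourier (T := T) n) 0
  simp only [fourierCoeff, neg_zero, fourier_zero, one_smul, Pi.single_apply] at h
  rw [h]
  by_cases hn : n = 0
  · simp [hn]
  · simp [hn, Ne.symm hn]

/-- Continuous functions on the (compact) circle are Haar integrable. [folklore] -/
theorem integrable_of_continuous_haar {E : Type*} [NormedAddCommGroup E] {f : AddCircle T → E}
    (hf : Continuous f) : Integrable f (haarAddCircle (T := T)) := by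
  have := hf.continuousOn.integrableOn_compact (μ := haarAddCircle) isCompact_univ
  rwa [integrableOn_univ] at this

variable {ι κ : Type*}

/-- A finite trigonometric sum `∑_{i ∈ s} c i · e_{n i}` on `AddCircle T`. [folklore] -/
def trigSum (s : Finset ι) (c : ι → ℂ) (n : ι → ℤ) (x : AddCircle T) : ℂ :=
  ∑ i ∈ s, c i * fourier (n i) x

omit hT in
/-- Trigonometric sums are continuous. [folklore] -/
theorem continuous_trigSum (s : Finset ι) (c : ι → ℂ) (n : ι → ℤ) :
    Continuous (trigSum (T := T) s c n) := by
  unfold trigSum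
  exact continuous_finsetSum _ fun i _ => continuous_const.mul (map_continuous _)

/-- Trigonometric sums are Haar integrable. [folklore] -/
theorem integrable_trigSum (s : Finset ι) (c : ι → ℂ) (n : ι → ℤ) :
    Integrable (trigSum (T := T) s c n) haarAddCircle :=
  integrable_of_continuous_haar (continuous_trigSum s c n)

omit hT in
/-- Product of trigonometric sums (`e_n e_m = e_{n+m}`). [folklore] -/
theorem trigSum_mul (s : Finset ι) (c : ι → ℂ) (n : ι → ℤ) (t : Finset κ) (d : κ → ℂ)
    (m : κ → ℤ) (x : AddCircle T) :
    trigSum s c n x * trigSum t d m x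
      = trigSum (s ×ˢ t) (fun p => c p.1 * d p.2) (fun p => n p.1 + m p.2) x := by
  unfold trigSum
  rw [sum_mul_sum, sum_product]
  refine sum_congr rfl fun i _ => sum_congr rfl fun j _ => ?_
  rw [fourier_add]
  ring

omit hT in
/-- Conjugate of a trigonometric sum (`conj e_n = e_{-n}`). [folklore] -/
theorem conj_trigSum (s : Finset ι) (c : ι → ℂ) (n : ι → ℤ) (x : AddCircle T) :
    conj (trigSum s c n x) = trigSum s (fun i => conj (c i)) (fun i => -n i) x := by
  simp only [trigSum, map_sum, map_mul, fourier_neg]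

/-- Haar integral of a trigonometric sum: only the zero frequencies survive. [folklore] -/
theorem integral_trigSum (s : Finset ι) (c : ι → ℂ) (n : ι → ℤ) :
    ∫ x, trigSum (T := T) s c n x ∂haarAddCircle = ∑ i ∈ s, if n i = 0 then c i else 0 := by
  unfold trigSum
  rw [integral_finsetSum]
  · refine sum_congr rfl fun i _ => ?_
    rw [integral_const_mul, integral_fourier_haar]
    split_ifs <;> simp
  · intro i _
    exact integrable_of_continuous_haar (continuous_const.mul (map_continuous _))

/-! ### The analytic part `p = ∑_{k=1}^K a_k e_k` and its moments -/

/-- The analytic part `p(x) = ∑_{k ∈ [1,K]} a_k e_k(x)` of a real trigonometric polynomial.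
[folklore] -/
def posTrigSum (K : ℕ) (a : ℕ → ℂ) (x : AddCircle T) : ℂ :=
  trigSum (Icc 1 K) (fun k => a k) (fun k => (k : ℤ)) x

omit hT in
/-- `p` is continuous. [folklore] -/
theorem continuous_posTrigSum (K : ℕ) (a : ℕ → ℂ) : Continuous (posTrigSum (T := T) K a) :=
  continuous_trigSum _ _ _

/-- `p` is Haar integrable. [folklore] -/
theorem integrable_posTrigSum (K : ℕ) (a : ℕ → ℂ) :
    Integrable (posTrigSum (T := T) K a) haarAddCircle :=
  integrable_trigSum _ _ _

/-- `∫ p = 0` (no zero frequency). [folklore] -/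
theorem integral_posTrigSum (K : ℕ) (a : ℕ → ℂ) :
    ∫ x, posTrigSum (T := T) K a x ∂haarAddCircle = 0 := by
  unfold posTrigSum
  rw [integral_trigSum]
  refine sum_eq_zero fun k hk => ?_
  rw [Finset.mem_Icc] at hk
  have : (k : ℤ) ≠ 0 := by omega
  rw [if_neg this]

/-- `∫ p² = 0`. [folklore] -/
theorem integral_posTrigSum_sq (K : ℕ) (a : ℕ → ℂ) :
    ∫ x, posTrigSum (T := T) K a x * posTrigSum K a x ∂haarAddCircle = 0 := by
  unfold posTrigSum
  simp_rw [trigSum_mul]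
  rw [integral_trigSum]
  refine sum_eq_zero fun p hp => ?_
  rw [mem_product, Finset.mem_Icc, Finset.mem_Icc] at hp
  have : (p.1 : ℤ) + (p.2 : ℤ) ≠ 0 := by omega
  rw [if_neg this]

/-- `∫ p³ = 0`. [folklore] -/
theorem integral_posTrigSum_cube (K : ℕ) (a : ℕ → ℂ) :
    ∫ x, posTrigSum (T := T) K a x * posTrigSum K a x * posTrigSum K a x ∂haarAddCircle = 0 := by
  unfold posTrigSum
  simp_rw [trigSum_mul]
  rw [integral_trigSum]
  refine sum_eq_zero fun p hp => ?_
  simp only [mem_product, Finset.mem_Icc] at hp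
  have : (p.1.1 : ℤ) + (p.1.2 : ℤ) + (p.2 : ℤ) ≠ 0 := by omega
  rw [if_neg this]

/-- `∫ p conj(p) = ∑ |a_k|²` (orthonormality). [folklore] -/
theorem integral_posTrigSum_mul_conj (K : ℕ) (a : ℕ → ℂ) :
    ∫ x, posTrigSum (T := T) K a x * conj (posTrigSum K a x) ∂haarAddCircle
      = ∑ k ∈ Icc 1 K, ((‖a k‖ ^ 2 : ℝ) : ℂ) := by
  unfold posTrigSum
  simp_rw [conj_trigSum, trigSum_mul]
  rw [integral_trigSum, sum_product]
  refine sum_congr rfl fun i hi => ?_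
  rw [sum_eq_single i]
  · simp [mul_conj, Complex.normSq_eq_norm_sq]
  · intro j _ hji
    have : (i : ℤ) + -(j : ℤ) ≠ 0 := by omega
    simp [this]
  · intro h; exact absurd hi h

/-- `∫ p² conj(p) = T`, the cubic coefficient sum. [folklore] -/
theorem integral_posTrigSum_sq_mul_conj (K : ℕ) (a : ℕ → ℂ) :
    ∫ x, posTrigSum (T := T) K a x * posTrigSum K a x * conj (posTrigSum K a x) ∂haarAddCircle
      = cubicCoeffSum K a := by
  unfold posTrigSum cubicCoeffSum
  simp_rw [conj_trigSum, trigSum_mul]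
  rw [integral_trigSum, sum_product, sum_product]
  refine sum_congr rfl fun i hi => sum_congr rfl fun j hj => ?_
  rw [Finset.mem_Icc] at hi hj
  by_cases hij : i + j ≤ K
  · rw [sum_eq_single (i + j)]
    · simp [hij]
    · intro l _ hl
      have : (i : ℤ) + (j : ℤ) + -(l : ℤ) ≠ 0 := by omega
      simp [this]
    · intro h
      exfalso; apply h
      rw [Finset.mem_Icc]; omega
  · rw [if_neg hij, mul_zero]
    refine sum_eq_zero fun l hl => ?_
    rw [Finset.mem_Icc] at hl
    have : (i : ℤ) + (j : ℤ) + -(l : ℤ) ≠ 0 := by omega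
    simp [this]

/-! ### The real trigonometric polynomial `g = a₀ + 2 Re p` and its first three moments -/

/-- The real trigonometric polynomial `g(x) = a₀ + 2 Re ∑_{k=1}^K a_k e_k(x)` (every real
trigonometric polynomial of degree `≤ K` has this form, `a₀ = ĝ(0)`, `a_k = ĝ(k)`). [folklore] -/
def realTrigPoly (K : ℕ) (a0 : ℝ) (a : ℕ → ℂ) (x : AddCircle T) : ℝ :=
  a0 + 2 * (posTrigSum K a x).re

omit hT in
/-- `g` is continuous. [folklore] -/
theorem continuous_realTrigPoly (K : ℕ) (a0 : ℝ) (a : ℕ → ℂ) :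
    Continuous (realTrigPoly (T := T) K a0 a) :=
  continuous_const.add
    (continuous_const.mul (Complex.continuous_re.comp (continuous_posTrigSum K a)))

omit hT in
/-- `g = a₀ + p + conj p` as a complex function. [folklore] -/
theorem coe_realTrigPoly (K : ℕ) (a0 : ℝ) (a : ℕ → ℂ) (x : AddCircle T) :
    (realTrigPoly K a0 a x : ℂ) = a0 + posTrigSum K a x + conj (posTrigSum K a x) := by
  unfold realTrigPoly
  push_cast
  rw [Complex.re_eq_add_conj]
  ring

/-- First moment `∫ g = a₀`. [folklore] -/
theorem integral_realTrigPoly (K : ℕ) (a0 : ℝ) (a : ℕ → ℂ) :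
    ∫ x, realTrigPoly (T := T) K a0 a x ∂haarAddCircle = a0 := by
  have hp := integrable_posTrigSum (T := T) K a
  have h : ∫ x, (realTrigPoly (T := T) K a0 a x : ℂ) ∂haarAddCircle = a0 := by
    simp_rw [coe_realTrigPoly]
    rw [integral_add, integral_add, integral_const, integral_conj]
    · simp [integral_posTrigSum]
    · exact integrable_const _
    · exact hp
    · exact (integrable_const _).add hp
    · exact integrable_of_continuous_haar
        (Complex.continuous_conj.comp (continuous_posTrigSum K a))
  rw [integral_complex_ofReal] at h
  exact_mod_cast h

/-- Second moment `∫ g² = a₀² + 2 ∑ |a_k|²`. [folklore] -/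
theorem integral_realTrigPoly_sq (K : ℕ) (a0 : ℝ) (a : ℕ → ℂ) :
    ∫ x, realTrigPoly (T := T) K a0 a x ^ 2 ∂haarAddCircle
      = a0 ^ 2 + 2 * ∑ k ∈ Icc 1 K, ‖a k‖ ^ 2 := by
  set p := posTrigSum (T := T) K a with hp_def
  have hpc : Continuous p := continuous_posTrigSum K a
  have hQc : Continuous fun x => 2 * (a0 : ℂ) * p x + p x * p x := by fun_prop
  have hQi := integrable_of_continuous_haar (T := T) hQc
  have hQci : Integrable (fun x => conj (2 * (a0 : ℂ) * p x + p x * p x)) haarAddCircle :=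
    integrable_of_continuous_haar (T := T) (Complex.continuous_conj.comp hQc)
  have hPc : Continuous fun x => p x * conj (p x) :=
    hpc.mul (Complex.continuous_conj.comp hpc)
  have hPi := integrable_of_continuous_haar (T := T) hPc
  have hpt : ∀ x, ((realTrigPoly K a0 a x : ℝ) : ℂ) ^ 2
      = (a0 : ℂ) ^ 2 + (2 * (a0 : ℂ) * p x + p x * p x)
        + conj (2 * (a0 : ℂ) * p x + p x * p x) + 2 * (p x * conj (p x)) := by
    intro x
    rw [coe_realTrigPoly, ← hp_def]
    simp only [map_add, map_mul, Complex.conj_ofReal, map_ofNat]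
    ring
  have hQ : ∫ x, (2 * (a0 : ℂ) * p x + p x * p x) ∂haarAddCircle = 0 := by
    rw [integral_add, integral_const_mul, hp_def, integral_posTrigSum, integral_posTrigSum_sq]
    · simp
    · exact (integrable_posTrigSum K a).const_mul _
    · exact integrable_of_continuous_haar (hpc.mul hpc)
  have h : ∫ x, ((realTrigPoly (T := T) K a0 a x : ℝ) : ℂ) ^ 2 ∂haarAddCircle
      = (a0 : ℂ) ^ 2 + 2 * ∑ k ∈ Icc 1 K, ((‖a k‖ ^ 2 : ℝ) : ℂ) := by
    simp_rw [hpt]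
    rw [integral_add, integral_add, integral_add, integral_const, integral_conj (f := fun x =>
      2 * (a0 : ℂ) * p x + p x * p x), hQ, integral_const_mul, hp_def,
      integral_posTrigSum_mul_conj]
    · simp
    · exact integrable_const _
    · exact hQi
    · exact (integrable_const _).add hQi
    · exact hQci
    · exact ((integrable_const _).add hQi).add hQci
    · exact hPi.const_mul _
  have h2 : ∫ x, ((realTrigPoly (T := T) K a0 a x : ℝ) : ℂ) ^ 2 ∂haarAddCircle
      = ((∫ x, realTrigPoly (T := T) K a0 a x ^ 2 ∂haarAddCircle : ℝ) : ℂ) := by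
    rw [← integral_complex_ofReal]
    simp
  rw [h2] at h
  exact_mod_cast h

/-- Third moment `∫ g³ = a₀³ + 6 a₀ ∑ |a_k|² + 6 Re T`. [folklore] -/
theorem integral_realTrigPoly_cube (K : ℕ) (a0 : ℝ) (a : ℕ → ℂ) :
    ∫ x, realTrigPoly (T := T) K a0 a x ^ 3 ∂haarAddCircle
      = a0 ^ 3 + 6 * a0 * (∑ k ∈ Icc 1 K, ‖a k‖ ^ 2) + 6 * (cubicCoeffSum K a).re := by
  set p := posTrigSum (T := T) K a with hp_def
  have hpc : Continuous p := continuous_posTrigSum K a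
  have hQc : Continuous fun x => 3 * (a0 : ℂ) ^ 2 * p x + 3 * (a0 : ℂ) * (p x * p x)
      + p x * p x * p x := by fun_prop
  have hQi := integrable_of_continuous_haar (T := T) hQc
  have hQci : Integrable (fun x => conj (3 * (a0 : ℂ) ^ 2 * p x + 3 * (a0 : ℂ) * (p x * p x)
      + p x * p x * p x)) haarAddCircle :=
    integrable_of_continuous_haar (T := T) (Complex.continuous_conj.comp hQc)
  have hPc : Continuous fun x => p x * conj (p x) := hpc.mul (Complex.continuous_conj.comp hpc)
  have hPi := integrable_of_continuous_haar (T := T) hPc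
  have hRc : Continuous fun x => p x * p x * conj (p x) :=
    (hpc.mul hpc).mul (Complex.continuous_conj.comp hpc)
  have hRi := integrable_of_continuous_haar (T := T) hRc
  have hRci : Integrable (fun x => conj (p x * p x * conj (p x))) haarAddCircle :=
    integrable_of_continuous_haar (T := T) (Complex.continuous_conj.comp hRc)
  have hpt : ∀ x, ((realTrigPoly K a0 a x : ℝ) : ℂ) ^ 3
      = (a0 : ℂ) ^ 3
        + (3 * (a0 : ℂ) ^ 2 * p x + 3 * (a0 : ℂ) * (p x * p x) + p x * p x * p x)
        + conj (3 * (a0 : ℂ) ^ 2 * p x + 3 * (a0 : ℂ) * (p x * p x) + p x * p x * p x)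
        + 6 * (a0 : ℂ) * (p x * conj (p x))
        + 3 * ((p x * p x * conj (p x)) + conj (p x * p x * conj (p x))) := by
    intro x
    rw [coe_realTrigPoly, ← hp_def]
    simp only [map_add, map_mul, map_pow, Complex.conj_ofReal, map_ofNat, Complex.conj_conj]
    ring
  have hQ : ∫ x, (3 * (a0 : ℂ) ^ 2 * p x + 3 * (a0 : ℂ) * (p x * p x) + p x * p x * p x)
      ∂haarAddCircle = 0 := by
    rw [integral_add, integral_add, integral_const_mul, integral_const_mul, hp_def,
      integral_posTrigSum, integral_posTrigSum_sq, integral_posTrigSum_cube]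
    · simp
    · exact (integrable_posTrigSum K a).const_mul _
    · exact (integrable_of_continuous_haar (hpc.mul hpc)).const_mul _
    · exact ((integrable_posTrigSum K a).const_mul _).add
        ((integrable_of_continuous_haar (hpc.mul hpc)).const_mul _)
    · exact integrable_of_continuous_haar ((hpc.mul hpc).mul hpc)
  have hR : ∫ x, ((p x * p x * conj (p x)) + conj (p x * p x * conj (p x))) ∂haarAddCircle
      = cubicCoeffSum K a + conj (cubicCoeffSum K a) := by
    rw [integral_add hRi hRci, integral_conj (f := fun x => p x * p x * conj (p x)), hp_def,
      integral_posTrigSum_sq_mul_conj]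
  have h : ∫ x, ((realTrigPoly (T := T) K a0 a x : ℝ) : ℂ) ^ 3 ∂haarAddCircle
      = (a0 : ℂ) ^ 3 + 6 * (a0 : ℂ) * ∑ k ∈ Icc 1 K, ((‖a k‖ ^ 2 : ℝ) : ℂ)
        + 3 * (cubicCoeffSum K a + conj (cubicCoeffSum K a)) := by
    simp_rw [hpt]
    rw [integral_add, integral_add, integral_add, integral_add, integral_const,
      integral_conj (f := fun x => 3 * (a0 : ℂ) ^ 2 * p x + 3 * (a0 : ℂ) * (p x * p x)
        + p x * p x * p x), hQ, integral_const_mul, integral_const_mul, hR, hp_def,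
      integral_posTrigSum_mul_conj]
    · simp
    · exact integrable_const _
    · exact hQi
    · exact (integrable_const _).add hQi
    · exact hQci
    · exact ((integrable_const _).add hQi).add hQci
    · exact hPi.const_mul _
    · exact (((integrable_const _).add hQi).add hQci).add (hPi.const_mul _)
    · exact (hRi.add hRci).const_mul _
  have h2 : ∫ x, ((realTrigPoly (T := T) K a0 a x : ℝ) : ℂ) ^ 3 ∂haarAddCircle
      = ((∫ x, realTrigPoly (T := T) K a0 a x ^ 3 ∂haarAddCircle : ℝ) : ℂ) := by
    rw [← integral_complex_ofReal]
    simp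
  rw [h2, Complex.add_conj] at h
  have h3 : ((a0 : ℂ) ^ 3 + 6 * (a0 : ℂ) * ∑ k ∈ Icc 1 K, ((‖a k‖ ^ 2 : ℝ) : ℂ)
      + 3 * ((2 * (cubicCoeffSum K a).re : ℝ) : ℂ))
      = ((a0 ^ 3 + 6 * a0 * (∑ k ∈ Icc 1 K, ‖a k‖ ^ 2) + 6 * (cubicCoeffSum K a).re : ℝ) : ℂ) := by
    push_cast
    ring
  rw [h3] at h
  exact_mod_cast h

end TrigSum

/-! ## 3. Jensen's inequality for `Ψ(x) = x³/3 + x²/2 - x² log x` -/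

section Jensen

/-- The comparison function `Ψ(x) = x³/3 + x²/2 - x² log x`; `Ψ'' = 2 (x - 1 - log x) ≥ 0`.
[folklore] -/
def jensenAux (x : ℝ) : ℝ := x ^ 3 / 3 + x ^ 2 / 2 - x ^ 2 * Real.log x

/-- `x ↦ x² log x` is continuous (Mathlib `Real.continuous_mul_log`). [folklore] -/
theorem continuous_sq_mul_log : Continuous fun x : ℝ => x ^ 2 * Real.log x := by
  have : (fun x : ℝ => x ^ 2 * Real.log x) = fun x => x * (x * Real.log x) := by
    funext x; ring
  rw [this]
  exact continuous_id.mul Real.continuous_mul_log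

/-- `Ψ` is continuous. [folklore] -/
theorem continuous_jensenAux : Continuous jensenAux := by
  unfold jensenAux
  exact ((continuous_pow 3).div_const 3 |>.add ((continuous_pow 2).div_const 2)).sub
    continuous_sq_mul_log

/-- `Ψ'(x) = x² - 2x log x` for `x > 0`. [folklore] -/
theorem hasDerivAt_jensenAux {x : ℝ} (hx : 0 < x) :
    HasDerivAt jensenAux (x ^ 2 - 2 * x * Real.log x) x := by
  unfold jensenAux
  have h1 : HasDerivAt (fun x : ℝ => x ^ 3 / 3 + x ^ 2 / 2) (x ^ 2 + x) x := by
    refine (((hasDerivAt_pow 3 x).div_const 3).add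
      ((hasDerivAt_pow 2 x).div_const 2)).congr_deriv ?_
    norm_num
  have h2 : HasDerivAt (fun x : ℝ => x ^ 2 * Real.log x) (2 * x * Real.log x + x) x := by
    refine ((hasDerivAt_pow 2 x).mul (Real.hasDerivAt_log hx.ne')).congr_deriv ?_
    field_simp
    norm_num; ring
  refine (h1.sub h2).congr_deriv ?_
  ring

/-- `(Ψ')'(x) = 2 (x - 1 - log x)` for `x > 0`. [folklore] -/
theorem hasDerivAt_deriv_jensenAux {x : ℝ} (hx : 0 < x) :
    HasDerivAt (fun x : ℝ => x ^ 2 - 2 * x * Real.log x) (2 * (x - 1 - Real.log x)) x := by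
  have h1 : HasDerivAt (fun x : ℝ => 2 * x * Real.log x) (2 * Real.log x + 2) x := by
    have := ((hasDerivAt_id x).const_mul 2).mul (Real.hasDerivAt_log hx.ne')
    refine this.congr_deriv ?_
    simp only [id]
    field_simp
  refine ((hasDerivAt_pow 2 x).sub h1).congr_deriv ?_
  norm_num; ring

/-- `Ψ` is convex on `[0, ∞)` (`Ψ'` is increasing on `(0, ∞)` since `log x ≤ x - 1`).
[folklore] -/
theorem convexOn_jensenAux : ConvexOn ℝ (Set.Ici 0) jensenAux := by
  have hint : interior (Set.Ici (0 : ℝ)) = Set.Ioi 0 := interior_Ici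
  refine MonotoneOn.convexOn_of_deriv (convex_Ici 0) continuous_jensenAux.continuousOn ?_ ?_
  · rw [hint]
    intro x hx
    exact (hasDerivAt_jensenAux hx).differentiableAt.differentiableWithinAt
  · rw [hint]
    have hmono : MonotoneOn (fun x : ℝ => x ^ 2 - 2 * x * Real.log x) (Set.Ioi 0) := by
      refine monotoneOn_of_deriv_nonneg (convex_Ioi 0) ?_ ?_ ?_
      · intro x hx
        exact (hasDerivAt_deriv_jensenAux hx).continuousAt.continuousWithinAt
      · rw [interior_Ioi]
        intro x hx
        exact (hasDerivAt_deriv_jensenAux hx).differentiableAt.differentiableWithinAt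
      · rw [interior_Ioi]
        intro x hx
        rw [(hasDerivAt_deriv_jensenAux hx).deriv]
        have := Real.add_one_le_exp (Real.log x)
        rw [Real.exp_log hx] at this
        linarith
    intro x hx y hy hxy
    rw [(hasDerivAt_jensenAux hx).deriv, (hasDerivAt_jensenAux hy).deriv]
    exact hmono hx hy hxy

variable {T : ℝ} [hT : Fact (0 < T)]

/-- **Jensen step.** For continuous `g ≥ 0` on the circle,
`∫ g² log g ≤ ∫ g³/3 + ∫ g²/2 - Ψ(∫ g)` (Jensen for the convex `Ψ` and the probability
measure `dθ/T`). [folklore] -/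
theorem integral_sq_mul_log_le_of_jensen {g : AddCircle T → ℝ} (hg : Continuous g)
    (hg0 : ∀ x, 0 ≤ g x) :
    ∫ x, g x ^ 2 * Real.log (g x) ∂haarAddCircle
      ≤ (∫ x, g x ^ 3 ∂haarAddCircle) / 3 + (∫ x, g x ^ 2 ∂haarAddCircle) / 2
        - jensenAux (∫ x, g x ∂haarAddCircle) := by
  have hJ : jensenAux (∫ x, g x ∂haarAddCircle) ≤ ∫ x, jensenAux (g x) ∂haarAddCircle :=
    convexOn_jensenAux.map_integral_le continuous_jensenAux.continuousOn isClosed_Ici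
      (ae_of_all _ fun x => (hg0 x : g x ∈ Set.Ici 0)) (integrable_of_continuous_haar hg)
      (integrable_of_continuous_haar (continuous_jensenAux.comp hg))
  have hsplit : ∫ x, jensenAux (g x) ∂haarAddCircle
      = (∫ x, g x ^ 3 ∂haarAddCircle) / 3 + (∫ x, g x ^ 2 ∂haarAddCircle) / 2
        - ∫ x, g x ^ 2 * Real.log (g x) ∂haarAddCircle := by
    unfold jensenAux
    rw [integral_sub, integral_add, integral_div, integral_div]
    · exact integrable_of_continuous_haar ((hg.pow 3).div_const 3)
    · exact integrable_of_continuous_haar ((hg.pow 2).div_const 2)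
    · exact integrable_of_continuous_haar
        (((hg.pow 3).div_const 3).add ((hg.pow 2).div_const 2))
    · exact integrable_of_continuous_haar (continuous_sq_mul_log.comp hg)
  linarith

end Jensen

/-! ## 4. The inequality for non-negative trigonometric polynomials -/

section TrigPolyLSI

variable {T : ℝ} [hT : Fact (0 < T)]

/-- **(1.1) for a non-negative trigonometric polynomial with `‖g‖₂ = 1`:**
`∫ g² log g ≤ 2 ∑_{k=1}^K k |a_k|² = ∑ₙ |n| |ĝ(n)|²` for `g = a₀ + 2 Re ∑ a_k e_k ≥ 0` with
`a₀² + 2 ∑ |a_k|² = 1` (Jensen step + moment identities + coefficient inequality).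
[cite: Weissler1980, §1 Thm 1 (1.1)] -/
theorem logSobolev_realTrigPoly_normalized (K : ℕ) (a0 : ℝ) (a : ℕ → ℂ)
    (hnorm : a0 ^ 2 + 2 * ∑ k ∈ Icc 1 K, ‖a k‖ ^ 2 = 1)
    (hg : ∀ x, 0 ≤ realTrigPoly (T := T) K a0 a x) :
    ∫ x, realTrigPoly (T := T) K a0 a x ^ 2 * Real.log (realTrigPoly K a0 a x) ∂haarAddCircle
      ≤ 2 * ∑ k ∈ Icc 1 K, (k : ℝ) * ‖a k‖ ^ 2 := by
  set M0 : ℝ := ∑ k ∈ Icc 1 K, ‖a k‖ ^ 2 with hM0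
  set M1 : ℝ := ∑ k ∈ Icc 1 K, (k : ℝ) * ‖a k‖ ^ 2 with hM1
  have ha0 : 0 ≤ a0 := by
    have := integral_nonneg (μ := haarAddCircle (T := T)) (f := realTrigPoly K a0 a) fun x => hg x
    rwa [integral_realTrigPoly] at this
  have hM0nn : 0 ≤ M0 := sum_nonneg fun k _ => sq_nonneg _
  have hM : M0 ≤ M1 := by
    refine sum_le_sum fun k hk => ?_
    rw [Finset.mem_Icc] at hk
    have h1 : (1 : ℝ) ≤ k := by exact_mod_cast hk.1
    nlinarith [sq_nonneg ‖a k‖]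
  have hTc : (cubicCoeffSum K a).re ≤ M0 * Real.sqrt (M1 - M0) :=
    (Complex.re_le_norm _).trans (norm_cubicCoeffSum_le K a)
  have hJ := integral_sq_mul_log_le_of_jensen (continuous_realTrigPoly K a0 a) hg
  rw [integral_realTrigPoly, integral_realTrigPoly_sq, integral_realTrigPoly_cube] at hJ
  have halg := coeff_logSobolev_of_normalized ha0 hM0nn hnorm hM hTc
  have key : (a0 ^ 3 + 6 * a0 * M0 + 6 * (cubicCoeffSum K a).re) / 3 + (a0 ^ 2 + 2 * M0) / 2
      - jensenAux a0 = a0 ^ 2 * Real.log a0 + 2 * a0 * M0 + M0 + 2 * (cubicCoeffSum K a).re := by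
    unfold jensenAux
    ring
  linarith

omit hT in
/-- Scaling the coefficients scales `g`: `g_{a₀/s, a/s} = g_{a₀,a} / s` for real `s`. [folklore] -/
theorem realTrigPoly_div (K : ℕ) (a0 : ℝ) (a : ℕ → ℂ) (s : ℝ) (x : AddCircle T) :
    realTrigPoly K (a0 / s) (fun k => a k / s) x = realTrigPoly K a0 a x / s := by
  unfold realTrigPoly posTrigSum trigSum
  have : ∑ k ∈ Icc 1 K, a k / s * fourier (k : ℤ) x
      = (∑ k ∈ Icc 1 K, a k * fourier (k : ℤ) x) / s := by
    rw [sum_div]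
    refine sum_congr rfl fun k _ => ?_
    ring
  rw [this, Complex.div_ofReal_re]
  ring

/-- **(1.1) for a non-negative trigonometric polynomial** `g = a₀ + 2 Re ∑_{k=1}^K a_k e_k ≥ 0`:
`∫ g² log g ≤ ∑ₙ |n| |ĝ(n)|² + ‖g‖₂² log ‖g‖₂`, with `∑ₙ |n| |ĝ(n)|² = 2 ∑ k |a_k|²` and
`‖g‖₂² = a₀² + 2 ∑ |a_k|²` (from the normalized case by homogeneity).
[cite: Weissler1980, §1 Thm 1 (1.1)] -/
theorem logSobolev_realTrigPoly (K : ℕ) (a0 : ℝ) (a : ℕ → ℂ)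
    (hg : ∀ x, 0 ≤ realTrigPoly (T := T) K a0 a x) :
    ∫ x, realTrigPoly (T := T) K a0 a x ^ 2 * Real.log (realTrigPoly K a0 a x) ∂haarAddCircle
      ≤ 2 * ∑ k ∈ Icc 1 K, (k : ℝ) * ‖a k‖ ^ 2
        + (a0 ^ 2 + 2 * ∑ k ∈ Icc 1 K, ‖a k‖ ^ 2)
          * Real.log (Real.sqrt (a0 ^ 2 + 2 * ∑ k ∈ Icc 1 K, ‖a k‖ ^ 2)) := by
  set M0 : ℝ := ∑ k ∈ Icc 1 K, ‖a k‖ ^ 2 with hM0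
  set M1 : ℝ := ∑ k ∈ Icc 1 K, (k : ℝ) * ‖a k‖ ^ 2 with hM1
  set m : ℝ := a0 ^ 2 + 2 * M0 with hm
  set g := realTrigPoly (T := T) K a0 a with hg_def
  have hM0nn : 0 ≤ M0 := sum_nonneg fun k _ => sq_nonneg _
  have hM1nn : 0 ≤ M1 := sum_nonneg fun k _ => mul_nonneg (Nat.cast_nonneg _) (sq_nonneg _)
  have hmnn : 0 ≤ m := by positivity
  rcases hmnn.eq_or_lt with hm0 | hmpos
  · -- degenerate case: all coefficients vanish, `g = 0`
    have ha0 : a0 = 0 := by nlinarith [sq_nonneg a0]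
    have hM00 : M0 = 0 := by nlinarith [sq_nonneg a0]
    have hak : ∀ k ∈ Icc 1 K, a k = 0 := by
      intro k hk
      have := (sum_eq_zero_iff_of_nonneg (fun k _ => sq_nonneg ‖a k‖)).mp hM00.symm.symm k hk
      · simpa using this
    have hg0 : ∀ x, g x = 0 := by
      intro x
      simp only [hg_def, realTrigPoly, posTrigSum, trigSum, ha0]
      rw [sum_eq_zero fun k hk => by rw [hak k hk, zero_mul]]
      simp
    simp only [hg0]
    rw [← hm0]
    simp only [Real.sqrt_zero, Real.log_zero, mul_zero, add_zero]
    simp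
    positivity
  · set s := Real.sqrt m with hs
    have hspos : 0 < s := Real.sqrt_pos.mpr hmpos
    have hs2 : s ^ 2 = m := Real.sq_sqrt hmpos.le
    -- the normalized polynomial
    have hnk : ∀ k, ‖a k / (s : ℂ)‖ ^ 2 = ‖a k‖ ^ 2 / m := by
      intro k
      rw [norm_div, Complex.norm_real, Real.norm_of_nonneg hspos.le, div_pow, hs2]
    have hnorm' : (a0 / s) ^ 2 + 2 * ∑ k ∈ Icc 1 K, ‖a k / s‖ ^ 2 = 1 := by
      simp_rw [hnk]
      rw [← sum_div, div_pow, hs2, ← hM0]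
      field_simp
      linarith [hm]
    have hg' : ∀ x, 0 ≤ realTrigPoly (T := T) K (a0 / s) (fun k => a k / s) x := by
      intro x
      rw [realTrigPoly_div]
      exact div_nonneg (hg x) hspos.le
    have key := logSobolev_realTrigPoly_normalized (T := T) K (a0 / s) (fun k => a k / s)
      hnorm' hg'
    -- rewrite both sides of `key` in terms of `g`
    have hlhs : ∀ x, realTrigPoly (T := T) K (a0 / s) (fun k => a k / s) x ^ 2
        * Real.log (realTrigPoly K (a0 / s) (fun k => a k / s) x)
        = (1 / m) * (g x ^ 2 * Real.log (g x)) - (Real.log s / m) * g x ^ 2 := by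
      intro x
      rw [realTrigPoly_div, ← hg_def]
      by_cases hx : g x = 0
      · simp [hx]
      · rw [Real.log_div hx hspos.ne', div_pow, hs2]
        ring
    have hrhs : 2 * ∑ k ∈ Icc 1 K, (k : ℝ) * ‖a k / (s : ℂ)‖ ^ 2 = 2 * M1 / m := by
      simp_rw [hnk, mul_div_assoc', ← sum_div]
      rw [← hM1]
      ring
    simp_rw [hlhs] at key
    have hgc : Continuous g := by rw [hg_def]; exact continuous_realTrigPoly (T := T) K a0 a
    have hI1 : Integrable (fun x => g x ^ 2 * Real.log (g x)) haarAddCircle :=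
      integrable_of_continuous_haar (continuous_sq_mul_log.comp hgc)
    have hI2 : Integrable (fun x => g x ^ 2) haarAddCircle :=
      integrable_of_continuous_haar (hgc.pow 2)
    have hsq : ∫ x, g x ^ 2 ∂haarAddCircle = m := by
      rw [hg_def, integral_realTrigPoly_sq]
    rw [hrhs, integral_sub (hI1.const_mul _) (hI2.const_mul _), integral_const_mul,
      integral_const_mul, hsq] at key
    -- key : 1/m ∫ g² log g - log s / m * m ≤ 2 M1 / m
    have e1 : 1 / m * ∫ x, g x ^ 2 * Real.log (g x) ∂haarAddCircle - Real.log s / m * m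
        = (∫ x, g x ^ 2 * Real.log (g x) ∂haarAddCircle - m * Real.log s) / m := by
      field_simp
    rw [e1, div_le_div_iff_of_pos_right hmpos] at key
    linarith

end TrigPolyLSI

end CircleLogSobolev

end Literature.Analysis.FunctionSpaces

namespace Literature.Analysis.FunctionSpaces

namespace CircleLogSobolev

/-! ## 5. The Fejér kernel and the Fejér means of a non-negative `L²` function -/

section Fejer

variable {T : ℝ} [hT : Fact (0 < T)]

/-- Reindexing `∑_{k<N+1} ψ(N+1-k) = ∑_{d=1}^{N+1} ψ(d)`. [folklore] -/
theorem sum_range_succ_sub_eq_sum_Icc (ψ : ℤ → ℂ) (N : ℕ) :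
    ∑ k ∈ range (N + 1), ψ ((N : ℤ) + 1 - k) = ∑ d ∈ Icc 1 (N + 1), ψ d := by
  induction N with
  | zero => simp
  | succ N ih =>
    rw [sum_range_succ', Finset.sum_Icc_succ_top (by omega)]
    push_cast
    have : ∀ k : ℕ, ((N : ℤ) + 1 + 1 - ((k : ℤ) + 1)) = (N : ℤ) + 1 - k := fun k => by ring
    simp_rw [this, ih]
    ring_nf

/-- Reindexing `∑_{j<N+1} ψ(j-(N+1)) = ∑_{d=1}^{N+1} ψ(-d)`. [folklore] -/
theorem sum_range_sub_succ_eq_sum_Icc (ψ : ℤ → ℂ) (N : ℕ) :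
    ∑ j ∈ range (N + 1), ψ ((j : ℤ) - (N + 1)) = ∑ d ∈ Icc 1 (N + 1), ψ (-(d : ℤ)) := by
  have := sum_range_succ_sub_eq_sum_Icc (fun z => ψ (-z)) N
  simp only [neg_sub] at this
  rw [← this]

/-- **Fejér regrouping.** `∑_{j,k<N+1} φ(j-k) = (N+1) φ(0) + ∑_{d=1}^N (N+1-d) (φ(d) + φ(-d))`
(the number of pairs `(j,k) ∈ [0,N]²` with `j - k = ±d` is `N+1-d`). [folklore] -/
theorem sum_range_sum_range_sub (φ : ℤ → ℂ) (N : ℕ) :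
    ∑ j ∈ range (N + 1), ∑ k ∈ range (N + 1), φ ((j : ℤ) - k)
      = (N + 1 : ℂ) * φ 0
        + ∑ d ∈ Icc 1 N, ((N + 1 - d : ℕ) : ℂ) * (φ d + φ (-(d : ℤ))) := by
  induction N with
  | zero => simp
  | succ N ih =>
    -- peel off the last row and the last column
    have hL : ∑ j ∈ range (N + 1 + 1), ∑ k ∈ range (N + 1 + 1), φ ((j : ℤ) - k)
        = (∑ j ∈ range (N + 1), ∑ k ∈ range (N + 1), φ ((j : ℤ) - k))
          + ∑ k ∈ range (N + 1), φ ((N : ℤ) + 1 - k)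
          + ∑ j ∈ range (N + 1), φ ((j : ℤ) - (N + 1)) + φ 0 := by
      rw [sum_range_succ]
      have h1 : ∀ j ∈ range (N + 1 + 1), ∑ k ∈ range (N + 1 + 1), φ ((j : ℤ) - k)
          = (∑ k ∈ range (N + 1), φ ((j : ℤ) - k)) + φ ((j : ℤ) - (N + 1)) := by
        intro j _
        rw [sum_range_succ]
        push_cast
        ring_nf
      rw [sum_congr rfl (fun j hj => h1 j (mem_range.mpr
        (lt_trans (mem_range.mp hj) (Nat.lt_succ_self _)))), sum_add_distrib,
        h1 (N + 1) (self_mem_range_succ _)]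
      push_cast
      have h2 : ((N : ℤ) + 1 - ((N : ℤ) + 1)) = 0 := by ring
      rw [h2]
      ring
    rw [hL, ih, sum_range_succ_sub_eq_sum_Icc, sum_range_sub_succ_eq_sum_Icc]
    -- compare with the right-hand side at `N+1`
    have hR : ∑ d ∈ Icc 1 (N + 1), ((N + 1 + 1 - d : ℕ) : ℂ) * (φ d + φ (-(d : ℤ)))
        = ∑ d ∈ Icc 1 N, ((N + 1 - d : ℕ) : ℂ) * (φ d + φ (-(d : ℤ)))
          + ∑ d ∈ Icc 1 (N + 1), (φ d + φ (-(d : ℤ))) := by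
      have h3 : ∀ d ∈ Icc 1 (N + 1), ((N + 1 + 1 - d : ℕ) : ℂ) * (φ d + φ (-(d : ℤ)))
          = ((N + 1 - d : ℕ) : ℂ) * (φ d + φ (-(d : ℤ))) + (φ d + φ (-(d : ℤ))) := by
        intro d hd
        rw [Finset.mem_Icc] at hd
        have : (N + 1 + 1 - d : ℕ) = (N + 1 - d) + 1 := by omega
        rw [this]
        push_cast
        ring
      rw [sum_congr rfl h3, sum_add_distrib, Finset.sum_Icc_succ_top (by omega)]
      simp
    rw [hR, sum_add_distrib]
    push_cast
    ring

/-- The Dirichlet-type sum `D_N(z) = ∑_{j=0}^N e_j(z)`. [folklore] -/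
def dirichletSum (N : ℕ) (z : AddCircle T) : ℂ := ∑ j ∈ range (N + 1), fourier (j : ℤ) z

/-- The **Fejér kernel** `F_N(z) = |D_N(z)|² / (N+1)` (Katznelson, *An introduction to harmonic
analysis*, Ch. I §2.5). [cite: Katznelson2004, Ch. I §2.5] -/
def fejerKernel (N : ℕ) (z : AddCircle T) : ℝ := ‖dirichletSum N z‖ ^ 2 / (N + 1)

omit hT in
/-- `F_N ≥ 0`. [cite: Katznelson2004, Ch. I §2.5] -/
theorem fejerKernel_nonneg (N : ℕ) (z : AddCircle T) : 0 ≤ fejerKernel N z := by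
  unfold fejerKernel; positivity

omit hT in
/-- `F_N` is continuous. [folklore] -/
theorem continuous_fejerKernel (N : ℕ) : Continuous (fejerKernel (T := T) N) := by
  unfold fejerKernel dirichletSum
  refine ((continuous_finsetSum _ fun j _ => map_continuous _).norm.pow 2).div_const _

omit hT in
/-- `F_N(z) = (1/(N+1)) ∑_{j,k=0}^N e_{j-k}(z)`. [cite: Katznelson2004, Ch. I §2.5] -/
theorem coe_fejerKernel (N : ℕ) (z : AddCircle T) :
    (fejerKernel N z : ℂ)
      = (∑ j ∈ range (N + 1), ∑ k ∈ range (N + 1), fourier ((j : ℤ) - k) z) / (N + 1) := by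
  unfold fejerKernel dirichletSum
  rw [Complex.ofReal_div, ← Complex.normSq_eq_norm_sq, ← Complex.mul_conj, map_sum, sum_mul_sum]
  push_cast
  congr 1
  refine sum_congr rfl fun j _ => sum_congr rfl fun k _ => ?_
  rw [← fourier_neg, ← fourier_add, sub_eq_add_neg]

omit hT in
/-- `e_n(x - y) = e_n(x) e_{-n}(y)`. [folklore] -/
theorem fourier_sub_apply (n : ℤ) (x y : AddCircle T) :
    fourier n (x - y) = fourier n x * fourier (-n) y := by
  rw [sub_eq_add_neg, fourier_apply, zsmul_add, AddCircle.toCircle_add, Circle.coe_mul,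
    ← fourier_apply, smul_neg, fourier_neg', fourier_neg]

/-- `∫ F(y) e_n(x-y) dy = F̂(n) e_n(x)`. [folklore] -/
theorem integral_mul_fourier_sub {F : AddCircle T → ℂ} (n : ℤ) (x : AddCircle T) :
    ∫ y, F y * fourier n (x - y) ∂haarAddCircle = fourierCoeff F n * fourier n x := by
  simp_rw [fourier_sub_apply]
  have : ∀ y, F y * (fourier n x * fourier (-n) y) = fourier n x * (fourier (-n) y • F y) := by
    intro y; rw [smul_eq_mul]; ring
  simp_rw [this, integral_const_mul]
  rw [fourierCoeff, mul_comm]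

/-- Conjugate symmetry of the Fourier coefficients of a real function:
`f̂(-n) = conj f̂(n)`. [folklore] -/
theorem fourierCoeff_neg_of_real (f : AddCircle T → ℝ) (n : ℤ) :
    fourierCoeff (fun y => (f y : ℂ)) (-n) = conj (fourierCoeff (fun y => (f y : ℂ)) n) := by
  unfold fourierCoeff
  rw [← integral_conj, neg_neg]
  refine integral_congr_ae (ae_of_all _ fun y => ?_)
  simp only [smul_eq_mul, map_mul, Complex.conj_ofReal, fourier_neg, Complex.conj_conj]

/-- The zeroth Fourier coefficient of a real function is real. [folklore] -/
theorem fourierCoeff_zero_of_real (f : AddCircle T → ℝ) :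
    ((fourierCoeff (fun y => (f y : ℂ)) 0).re : ℂ) = fourierCoeff (fun y => (f y : ℂ)) 0 := by
  have h := fourierCoeff_neg_of_real f 0
  rw [neg_zero] at h
  exact Complex.conj_eq_iff_re.mp h.symm

/-- The **Fejér mean** `σ_N f (x) = ∫ f(y) F_N(x - y) dy` of a real function. [cite: Katznelson2004, Ch. I §2.5] -/
def fejerMean (N : ℕ) (f : AddCircle T → ℝ) (x : AddCircle T) : ℝ :=
  ∫ y, f y * fejerKernel N (x - y) ∂haarAddCircle

/-- `σ_N f ≥ 0` for `f ≥ 0` (positivity of the Fejér kernel). [cite: Katznelson2004, Ch. I §2.5] -/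
theorem fejerMean_nonneg (N : ℕ) {f : AddCircle T → ℝ} (hf : ∀ y, 0 ≤ f y) (x : AddCircle T) :
    0 ≤ fejerMean N f x :=
  integral_nonneg fun y => mul_nonneg (hf y) (fejerKernel_nonneg N _)

/-- The Fejér weights times the Fourier coefficients: `a_d = (1 - d/(N+1)) f̂(d)`. [folklore] -/
def fejerCoeff (N : ℕ) (f : AddCircle T → ℝ) (d : ℕ) : ℂ :=
  ((N + 1 - d : ℕ) : ℂ) / (N + 1) * fourierCoeff (fun y => (f y : ℂ)) d

/-- **The Fejér mean is a real trigonometric polynomial**: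
`σ_N f = f̂(0) + 2 Re ∑_{d=1}^N (1 - d/(N+1)) f̂(d) e_d`. [cite: Katznelson2004, Ch. I §2.5] -/
theorem fejerMean_eq_realTrigPoly (N : ℕ) {f : AddCircle T → ℝ} (hf : Integrable f haarAddCircle)
    (x : AddCircle T) :
    fejerMean N f x
      = realTrigPoly N (fourierCoeff (fun y => (f y : ℂ)) 0).re (fejerCoeff N f) x := by
  have hFi : Integrable (fun y => (f y : ℂ)) haarAddCircle := hf.ofReal
  set φ : ℤ → ℂ := fun n => fourierCoeff (fun y => (f y : ℂ)) n * fourier n x with hφ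
  have hint : ∀ n : ℤ, Integrable (fun y => (f y : ℂ) * fourier n (x - y)) haarAddCircle := by
    intro n
    have := (hFi.fourier_smul (-n)).const_mul (fourier n x)
    refine this.congr (ae_of_all _ fun y => ?_)
    simp only [fourier_sub_apply, smul_eq_mul]
    ring
  -- the complexified left-hand side
  have hlhs : (fejerMean N f x : ℂ)
      = (∑ j ∈ range (N + 1), ∑ k ∈ range (N + 1), φ ((j : ℤ) - k)) / (N + 1) := by
    unfold fejerMean
    rw [← integral_complex_ofReal]
    push_cast
    simp_rw [coe_fejerKernel, mul_div_assoc', integral_div, mul_sum]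
    rw [integral_finsetSum]
    · congr 1
      refine sum_congr rfl fun j _ => ?_
      rw [integral_finsetSum]
      · refine sum_congr rfl fun k _ => ?_
        rw [hφ, integral_mul_fourier_sub]
      · intro k _
        exact hint _
    · intro j _
      exact integrable_finsetSum _ fun k _ => hint _
  -- the complexified right-hand side
  have hrhs : (realTrigPoly N (fourierCoeff (fun y => (f y : ℂ)) 0).re (fejerCoeff N f) x : ℂ)
      = φ 0 + ∑ d ∈ Icc 1 N, ((N + 1 - d : ℕ) : ℂ) / (N + 1) * (φ d + φ (-(d : ℤ))) := by
    rw [coe_realTrigPoly, fourierCoeff_zero_of_real]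
    unfold posTrigSum trigSum
    rw [map_sum, add_assoc, ← sum_add_distrib]
    congr 1
    · simp [hφ]
    · refine sum_congr rfl fun d _ => ?_
      simp only [fejerCoeff, hφ, map_mul, map_div₀, map_natCast, ← fourier_neg,
        ← fourierCoeff_neg_of_real]
      have : conj ((N : ℂ) + 1) = (N : ℂ) + 1 := by
        rw [map_add, map_natCast, map_one]
      rw [this]
      ring
  have key : (fejerMean N f x : ℂ)
      = (realTrigPoly N (fourierCoeff (fun y => (f y : ℂ)) 0).re (fejerCoeff N f) x : ℂ) := by
    rw [hlhs, hrhs, sum_range_sum_range_sub, add_div]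
    congr 1
    · rw [mul_div_cancel_left₀]
      exact_mod_cast Nat.succ_ne_zero N
    · rw [sum_div]
      refine sum_congr rfl fun d _ => ?_
      ring
  exact_mod_cast key

end Fejer

end CircleLogSobolev

end Literature.Analysis.FunctionSpaces

namespace Literature.Analysis.FunctionSpaces

namespace CircleLogSobolev

/-! ## 6. Fourier-side bookkeeping for a real `L²` function -/

section L2

variable {T : ℝ} [hT : Fact (0 < T)]

omit hT in
/-- `|p(x)| ≤ ∑ |a_d|`. [folklore] -/
theorem norm_posTrigSum_le (K : ℕ) (a : ℕ → ℂ) (x : AddCircle T) :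
    ‖posTrigSum K a x‖ ≤ ∑ d ∈ Icc 1 K, ‖a d‖ := by
  unfold posTrigSum trigSum
  refine (norm_sum_le _ _).trans (sum_le_sum fun d _ => ?_)
  rw [norm_mul, fourier_apply, Circle.norm_coe, mul_one]

/-- `∫ p f = ∑_d a_d conj f̂(d)` for integrable real `f`. [folklore] -/
theorem integral_posTrigSum_mul (K : ℕ) (a : ℕ → ℂ) {f : AddCircle T → ℝ}
    (hf : Integrable f haarAddCircle) :
    Integrable (fun x => posTrigSum (T := T) K a x * (f x : ℂ)) haarAddCircle ∧
    ∫ x, posTrigSum (T := T) K a x * (f x : ℂ) ∂haarAddCircle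
      = ∑ d ∈ Icc 1 K, a d * conj (fourierCoeff (fun y => (f y : ℂ)) d) := by
  have hFi : Integrable (fun y => (f y : ℂ)) haarAddCircle := hf.ofReal
  have heq : (fun x => posTrigSum (T := T) K a x * (f x : ℂ))
      = fun x => ∑ d ∈ Icc 1 K, a d * (fourier (d : ℤ) x • (f x : ℂ)) := by
    funext x
    simp only [posTrigSum, trigSum, sum_mul, smul_eq_mul]
    refine sum_congr rfl fun d _ => ?_
    ring
  rw [heq]
  refine ⟨integrable_finsetSum _ fun d _ => (hFi.fourier_smul _).const_mul _, ?_⟩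
  rw [integral_finsetSum _ (fun d _ => (hFi.fourier_smul _).const_mul _)]
  refine sum_congr rfl fun d _ => ?_
  rw [integral_const_mul, ← fourierCoeff_neg_of_real]
  simp [fourierCoeff]

/-- `Re f̂(0) = ∫ f` for real `f`. [folklore] -/
theorem re_fourierCoeff_zero (f : AddCircle T → ℝ) :
    (fourierCoeff (fun y => (f y : ℂ)) 0).re = ∫ y, f y ∂haarAddCircle := by
  have : fourierCoeff (fun y => (f y : ℂ)) 0 = ∫ y, (f y : ℂ) ∂haarAddCircle := by
    simp [fourierCoeff]
  rw [this, integral_complex_ofReal, Complex.ofReal_re]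

/-- `|f̂(0)|² = (Re f̂(0))²` for real `f`. [folklore] -/
theorem norm_sq_fourierCoeff_zero (f : AddCircle T → ℝ) :
    ‖fourierCoeff (fun y => (f y : ℂ)) 0‖ ^ 2 = (fourierCoeff (fun y => (f y : ℂ)) 0).re ^ 2 := by
  rw [← fourierCoeff_zero_of_real, Complex.norm_real, Real.norm_eq_abs, sq_abs, Complex.ofReal_re]

/-- `∫ g f = a₀ ∫ f + 2 Re ∑_d a_d conj f̂(d)` for `g = a₀ + 2 Re ∑ a_d e_d` and integrable real `f`.
[folklore] -/
theorem integral_realTrigPoly_mul (K : ℕ) (a0 : ℝ) (a : ℕ → ℂ) {f : AddCircle T → ℝ}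
    (hf : Integrable f haarAddCircle) :
    Integrable (fun x => realTrigPoly (T := T) K a0 a x * f x) haarAddCircle ∧
    ∫ x, realTrigPoly (T := T) K a0 a x * f x ∂haarAddCircle
      = a0 * ∫ x, f x ∂haarAddCircle
        + 2 * (∑ d ∈ Icc 1 K, a d * conj (fourierCoeff (fun y => (f y : ℂ)) d)).re := by
  have h1 : ∀ x, realTrigPoly (T := T) K a0 a x * f x
      = a0 * f x + 2 * ((posTrigSum K a x).re * f x) := by
    intro x; unfold realTrigPoly; ring
  have hint : Integrable (fun x => (posTrigSum (T := T) K a x).re * f x) haarAddCircle :=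
    hf.bdd_mul (c := ∑ d ∈ Icc 1 K, ‖a d‖)
      (Complex.continuous_re.comp (continuous_posTrigSum K a)).aestronglyMeasurable
      (ae_of_all _ fun x => by
        rw [Real.norm_eq_abs]
        exact (Complex.abs_re_le_norm _).trans (norm_posTrigSum_le K a x))
  have hfun : (fun x => realTrigPoly (T := T) K a0 a x * f x)
      = fun x => a0 * f x + 2 * ((posTrigSum K a x).re * f x) := funext h1
  rw [hfun]
  refine ⟨(hf.const_mul _).add (hint.const_mul _), ?_⟩
  rw [integral_add (hf.const_mul _) (hint.const_mul _), integral_const_mul, integral_const_mul]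
  congr 2
  have h2 : ∀ x, (posTrigSum (T := T) K a x).re * f x
      = RCLike.re (posTrigSum (T := T) K a x * (f x : ℂ)) := by
    intro x
    simp
  simp_rw [h2]
  obtain ⟨hI, hE⟩ := integral_posTrigSum_mul (T := T) K a hf
  rw [integral_re hI, hE]
  rfl

/-- **Parseval** for a real `L²` function: `∑_{n ∈ ℤ} |f̂(n)|² = ∫ f²` (Mathlib
`hasSum_sq_fourierCoeff`). [folklore] -/
theorem hasSum_sq_fourierCoeff_of_real {f : AddCircle T → ℝ} (hf : MemLp f 2 haarAddCircle) :
    HasSum (fun n : ℤ => ‖fourierCoeff (fun y => (f y : ℂ)) n‖ ^ 2)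
      (∫ x, f x ^ 2 ∂haarAddCircle) := by
  have hF : MemLp (fun y => (f y : ℂ)) 2 haarAddCircle := hf.ofReal
  have h := hasSum_sq_fourierCoeff (hF.toLp _)
  have hcoe : fourierCoeff (hF.toLp _) = fourierCoeff (fun y => (f y : ℂ)) :=
    fourierCoeff_congr_ae (MemLp.coeFn_toLp hF)
  have hint : ∫ t, ‖(hF.toLp _) t‖ ^ 2 ∂haarAddCircle = ∫ x, f x ^ 2 ∂haarAddCircle := by
    refine integral_congr_ae ?_
    filter_upwards [MemLp.coeFn_toLp hF] with t ht
    rw [ht, Complex.norm_real, Real.norm_eq_abs, sq_abs]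
  rwa [hcoe, hint] at h

/-- Folding Parseval over `n ↦ -n` for a real function:
`∫ f² = |f̂(0)|² + 2 ∑_{n ≥ 1} |f̂(n)|²`, with the one-sided series summable. [folklore] -/
theorem integral_sq_eq_tsum_of_real {f : AddCircle T → ℝ} (hf : MemLp f 2 haarAddCircle) :
    Summable (fun n : ℕ => ‖fourierCoeff (fun y => (f y : ℂ)) ((n + 1 : ℕ) : ℤ)‖ ^ 2) ∧
    ∫ x, f x ^ 2 ∂haarAddCircle
      = ‖fourierCoeff (fun y => (f y : ℂ)) 0‖ ^ 2
        + 2 * ∑' n : ℕ, ‖fourierCoeff (fun y => (f y : ℂ)) ((n + 1 : ℕ) : ℤ)‖ ^ 2 := by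
  set u : ℤ → ℝ := fun n => ‖fourierCoeff (fun y => (f y : ℂ)) n‖ ^ 2 with hu
  set m : ℝ := ∫ x, f x ^ 2 ∂haarAddCircle with hm
  have h := hasSum_sq_fourierCoeff_of_real hf
  have h2 := h.nat_add_neg
  have hsymm : ∀ n : ℕ, u (-(n : ℤ)) = u n := by
    intro n
    simp only [hu, fourierCoeff_neg_of_real, Complex.norm_conj]
  have h3 : HasSum (fun n : ℕ => u n) ((m + u 0) / 2) := by
    have := h2.div_const 2
    refine this.congr_fun fun n => ?_
    simp only [hu, fourierCoeff_neg_of_real, Complex.norm_conj]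
    ring
  have h4 : Summable (fun n : ℕ => u n) := h3.summable
  have h5 : Summable (fun n : ℕ => u (((n + 1 : ℕ) : ℤ))) := (summable_nat_add_iff 1).mpr h4
  refine ⟨h5, ?_⟩
  have h6 := h4.tsum_eq_zero_add
  have h7 := h3.tsum_eq
  change ∑' n : ℕ, u n = (m + u 0) / 2 at h7
  change m = u 0 + 2 * ∑' n : ℕ, u (((n + 1 : ℕ) : ℤ))
  push_cast at h6 ⊢
  linarith

/-- One-sided lower bound for the Sobolev-type sum:
`2 ∑_{d=1}^N d |f̂(d)|² ≤ ∑_{n ∈ ℤ} |n| |f̂(n)|²`. [folklore] -/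
theorem two_mul_sum_le_tsum_abs_mul (f : AddCircle T → ℝ) (N : ℕ)
    (hS : Summable (fun n : ℤ => |(n : ℝ)| * ‖fourierCoeff (fun y => (f y : ℂ)) n‖ ^ 2)) :
    2 * ∑ d ∈ Icc 1 N, (d : ℝ) * ‖fourierCoeff (fun y => (f y : ℂ)) d‖ ^ 2
      ≤ ∑' n : ℤ, |(n : ℝ)| * ‖fourierCoeff (fun y => (f y : ℂ)) n‖ ^ 2 := by
  set v : ℤ → ℝ := fun n => |(n : ℝ)| * ‖fourierCoeff (fun y => (f y : ℂ)) n‖ ^ 2 with hv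
  have h := hS.hasSum.nat_add_neg
  have hv0 : v 0 = 0 := by simp [hv]
  rw [hv0, add_zero] at h
  have hsymm : ∀ n : ℕ, v (-(n : ℤ)) = v n := by
    intro n
    simp only [hv, fourierCoeff_neg_of_real, Complex.norm_conj, Int.cast_neg, Int.cast_natCast,
      abs_neg]
  have hle := sum_le_hasSum (Icc 1 N) (fun n _ => by positivity) h
  refine le_trans (le_of_eq ?_) hle
  rw [mul_sum]
  refine sum_congr rfl fun d _ => ?_
  rw [hsymm]
  simp only [hv, Int.cast_natCast, Nat.abs_cast]
  ring

end L2

end CircleLogSobolev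

end Literature.Analysis.FunctionSpaces

namespace Literature.Analysis.FunctionSpaces

namespace CircleLogSobolev

/-! ## 7. The Fejér weights and the two limits `‖σ_N f‖₂ → ‖f‖₂`, `‖σ_N f - f‖₂ → 0` -/

section Limits

open Filter Topology

variable {T : ℝ} [hT : Fact (0 < T)]

/-- The Fejér weight `w_{N,d} = (N+1-d)/(N+1)` (natural subtraction: `0` for `d > N`). [folklore] -/
def fejerWeight (N d : ℕ) : ℝ := ((N + 1 - d : ℕ) : ℝ) / (N + 1)

/-- `0 ≤ w_{N,d}`. [folklore] -/
theorem fejerWeight_nonneg (N d : ℕ) : 0 ≤ fejerWeight N d := by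
  unfold fejerWeight; positivity

/-- `w_{N,d} ≤ 1`. [folklore] -/
theorem fejerWeight_le_one (N d : ℕ) : fejerWeight N d ≤ 1 := by
  unfold fejerWeight
  refine div_le_one_of_le₀ ?_ (by positivity)
  exact_mod_cast Nat.sub_le _ _

/-- `w_{N,d} = 0` for `d > N`. [folklore] -/
theorem fejerWeight_eq_zero {N d : ℕ} (h : N < d) : fejerWeight N d = 0 := by
  unfold fejerWeight
  rw [Nat.sub_eq_zero_of_le (by omega)]
  simp

/-- `w_{N,d} → 1` as `N → ∞`. [folklore] -/
theorem tendsto_fejerWeight (d : ℕ) : Tendsto (fun N => fejerWeight N d) atTop (𝓝 1) := by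
  have h0 : Tendsto (fun N : ℕ => (d : ℝ) / ((N : ℝ) + 1)) atTop (𝓝 0) := by
    have := (tendsto_const_div_atTop_nhds_zero_nat (d : ℝ)).comp (tendsto_add_atTop_nat 1)
    refine this.congr fun N => ?_
    simp [Function.comp]
  have h : Tendsto (fun N : ℕ => 1 - (d : ℝ) / ((N : ℝ) + 1)) atTop (𝓝 (1 - 0)) :=
    tendsto_const_nhds.sub h0
  rw [sub_zero] at h
  refine h.congr' ?_
  filter_upwards [Filter.eventually_ge_atTop d] with N hN
  unfold fejerWeight
  rw [Nat.cast_sub (by omega)]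
  push_cast
  field_simp

/-- `fejerCoeff N f d = w_{N,d} f̂(d)`. [folklore] -/
theorem fejerCoeff_eq (N : ℕ) (f : AddCircle T → ℝ) (d : ℕ) :
    fejerCoeff N f d = (fejerWeight N d : ℂ) * fourierCoeff (fun y => (f y : ℂ)) d := by
  unfold fejerCoeff fejerWeight
  push_cast
  ring

/-- `|fejerCoeff N f d| = w_{N,d} |f̂(d)|`. [folklore] -/
theorem norm_fejerCoeff (N : ℕ) (f : AddCircle T → ℝ) (d : ℕ) :
    ‖fejerCoeff N f d‖ = fejerWeight N d * ‖fourierCoeff (fun y => (f y : ℂ)) d‖ := by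
  rw [fejerCoeff_eq, norm_mul, Complex.norm_real, Real.norm_of_nonneg (fejerWeight_nonneg N d)]

omit hT in
/-- Reindexing `∑_{n<N} F(n+1) = ∑_{d=1}^N F(d)`. [folklore] -/
theorem sum_range_succ_eq_sum_Icc' {M : Type*} [AddCommMonoid M] (F : ℕ → M) (N : ℕ) :
    ∑ n ∈ range N, F (n + 1) = ∑ d ∈ Icc 1 N, F d := by
  induction N with
  | zero => simp
  | succ N ih => rw [sum_range_succ, Finset.sum_Icc_succ_top (by omega), ih]

/-- A finitely supported weighted coefficient sum as a series:
`∑_{d=1}^N c(w_{N,d}) |f̂(d)|² = ∑_{n ≥ 0} c(w_{N,n+1}) |f̂(n+1)|²` when `c(0) = 0`. [folklore] -/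
theorem sum_Icc_eq_tsum_fejerWeight (f : AddCircle T → ℝ) (c : ℝ → ℝ) (hc : c 0 = 0) (N : ℕ) :
    ∑ d ∈ Icc 1 N, c (fejerWeight N d) * ‖fourierCoeff (fun y => (f y : ℂ)) d‖ ^ 2
      = ∑' n : ℕ, c (fejerWeight N (n + 1))
          * ‖fourierCoeff (fun y => (f y : ℂ)) ((n + 1 : ℕ) : ℤ)‖ ^ 2 := by
  rw [tsum_eq_sum (s := range N)]
  · exact (sum_range_succ_eq_sum_Icc' (fun d => c (fejerWeight N d)
      * ‖fourierCoeff (fun y => (f y : ℂ)) d‖ ^ 2) N).symm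
  · intro n hn
    rw [mem_range, not_lt] at hn
    rw [fejerWeight_eq_zero (by omega), hc, zero_mul]

/-- **Tannery step.** For a weight profile `c` with `|c| ≤ 1` on `[0,1]` and `c(w) → L` as
`w → 1`: `∑_{n ≥ 0} c(w_{N,n+1}) |f̂(n+1)|² → ∑_{n ≥ 0} L |f̂(n+1)|²` (dominated convergence for
series, Mathlib `tendsto_tsum_of_dominated_convergence`; used with `c(w) = w²` and
`c(w) = (1-w)²`). [folklore] -/
theorem tendsto_tsum_fejerWeight {f : AddCircle T → ℝ} (hf : MemLp f 2 haarAddCircle)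
    (c : ℝ → ℝ) (hc1 : ∀ w, 0 ≤ w → w ≤ 1 → |c w| ≤ 1) (L : ℝ)
    (hcL : Tendsto c (𝓝 1) (𝓝 L)) :
    Tendsto (fun N => ∑' n : ℕ, c (fejerWeight N (n + 1))
        * ‖fourierCoeff (fun y => (f y : ℂ)) ((n + 1 : ℕ) : ℤ)‖ ^ 2) atTop
      (𝓝 (∑' n : ℕ, L * ‖fourierCoeff (fun y => (f y : ℂ)) ((n + 1 : ℕ) : ℤ)‖ ^ 2)) := by
  obtain ⟨hsum, -⟩ := integral_sq_eq_tsum_of_real hf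
  refine tendsto_tsum_of_dominated_convergence hsum (fun n => ?_) (Eventually.of_forall ?_)
  · exact ((hcL.comp (tendsto_fejerWeight (n + 1))).mul_const _)
  · intro N n
    rw [Real.norm_eq_abs, abs_mul]
    refine (mul_le_mul_of_nonneg_right (hc1 _ (fejerWeight_nonneg _ _) (fejerWeight_le_one _ _))
      (abs_nonneg _)).trans ?_
    rw [one_mul, abs_of_nonneg (sq_nonneg _)]

/-- The squared `L²` norm of the Fejér mean: `‖σ_N f‖₂² = (Re f̂(0))² + 2 ∑_d |fejerCoeff|²`
converges to `‖f‖₂²`. [cite: Weissler1980, §1, proof of Thm 1 (approximation step)] -/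
theorem tendsto_sqNorm_fejer {f : AddCircle T → ℝ} (hf : MemLp f 2 haarAddCircle) :
    Tendsto (fun N => (fourierCoeff (fun y => (f y : ℂ)) 0).re ^ 2
        + 2 * ∑ d ∈ Icc 1 N, ‖fejerCoeff N f d‖ ^ 2) atTop
      (𝓝 (∫ x, f x ^ 2 ∂haarAddCircle)) := by
  obtain ⟨-, hm⟩ := integral_sq_eq_tsum_of_real hf
  rw [hm, norm_sq_fourierCoeff_zero]
  refine tendsto_const_nhds.add (Tendsto.const_mul 2 ?_)
  have hc : Continuous (fun w : ℝ => w ^ 2) := by fun_prop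
  have h := tendsto_tsum_fejerWeight hf (fun w => w ^ 2)
    (fun w h0 h1 => by rw [abs_of_nonneg (sq_nonneg w)]; nlinarith) 1
    (by simpa using hc.tendsto (1 : ℝ))
  simp only [one_mul] at h
  refine h.congr fun N => ?_
  rw [← sum_Icc_eq_tsum_fejerWeight f (fun w => w ^ 2) (by norm_num) N]
  refine sum_congr rfl fun d _ => ?_
  rw [norm_fejerCoeff, mul_pow]

/-- The Fejér means as trigonometric polynomials: `σ_N f = f̂(0) + 2 Re ∑_{d=1}^N w_{N,d} f̂(d) e_d`
(`fejerMean_eq_realTrigPoly`). [folklore] -/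
abbrev fejerPoly (N : ℕ) (f : AddCircle T → ℝ) : AddCircle T → ℝ :=
  realTrigPoly N (fourierCoeff (fun y => (f y : ℂ)) 0).re (fejerCoeff N f)

/-- `‖σ_N f - f‖₂² → 0`: by the moment formulas,
`∫ (σ_N f - f)² = 2 ∑_{n ≥ 1} (1 - w_{N,n})² |f̂(n)|²`, and Tannery's theorem.
[cite: Weissler1980, §1, proof of Thm 1 (approximation step)] -/
theorem tendsto_integral_sq_fejerPoly_sub {f : AddCircle T → ℝ} (hf : MemLp f 2 haarAddCircle) :
    Tendsto (fun N => ∫ x, (fejerPoly N f x - f x) ^ 2 ∂haarAddCircle) atTop (𝓝 0) := by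
  have hf1 : Integrable f haarAddCircle := hf.integrable one_le_two
  obtain ⟨hsum, hm⟩ := integral_sq_eq_tsum_of_real hf
  set u' : ℕ → ℝ := fun n => ‖fourierCoeff (fun y => (f y : ℂ)) ((n + 1 : ℕ) : ℤ)‖ ^ 2 with hu'
  set a0 : ℝ := (fourierCoeff (fun y => (f y : ℂ)) 0).re with ha0
  -- the three moments
  have hGG : ∀ N, ∫ x, fejerPoly N f x ^ 2 ∂haarAddCircle
      = a0 ^ 2 + 2 * ∑' n : ℕ, (fejerWeight N (n + 1)) ^ 2 * u' n := by
    intro N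
    rw [fejerPoly, integral_realTrigPoly_sq, ← sum_Icc_eq_tsum_fejerWeight f (fun w => w ^ 2)
      (by norm_num) N]
    congr 2
    refine sum_congr rfl fun d _ => ?_
    rw [norm_fejerCoeff, mul_pow]
  have hGf : ∀ N, ∫ x, fejerPoly N f x * f x ∂haarAddCircle
      = a0 ^ 2 + 2 * ∑' n : ℕ, fejerWeight N (n + 1) * u' n := by
    intro N
    rw [fejerPoly, (integral_realTrigPoly_mul N _ _ hf1).2, ← re_fourierCoeff_zero, ← ha0, sq,
      ← sum_Icc_eq_tsum_fejerWeight f (fun w => w) rfl N, Complex.re_sum]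
    congr 2
    refine sum_congr rfl fun d _ => ?_
    rw [fejerCoeff_eq, mul_assoc, Complex.mul_conj, Complex.normSq_eq_norm_sq,
      ← Complex.ofReal_mul, Complex.ofReal_re]
  have hff : ∫ x, f x ^ 2 ∂haarAddCircle = a0 ^ 2 + 2 * ∑' n : ℕ, u' n := by
    rw [hm, norm_sq_fourierCoeff_zero]
  -- integrability
  have hGc : ∀ N, Continuous (fejerPoly (T := T) N f) := fun N => continuous_realTrigPoly _ _ _
  have hG2 : ∀ N, Integrable (fun x => fejerPoly (T := T) N f x ^ 2) haarAddCircle :=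
    fun N => integrable_of_continuous_haar ((hGc N).pow 2)
  have hGfI : ∀ N, Integrable (fun x => fejerPoly (T := T) N f x * f x) haarAddCircle :=
    fun N => (integral_realTrigPoly_mul N _ _ hf1).1
  have hf2I : Integrable (fun x => f x ^ 2) haarAddCircle := hf.integrable_sq
  -- summability of the weighted series
  have hsw : ∀ N, Summable (fun n => fejerWeight N (n + 1) * u' n) := fun N =>
    hsum.of_nonneg_of_le (fun n => mul_nonneg (fejerWeight_nonneg _ _) (sq_nonneg _))
      (fun n => mul_le_of_le_one_left (sq_nonneg _) (fejerWeight_le_one _ _))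
  have hsw2 : ∀ N, Summable (fun n => fejerWeight N (n + 1) ^ 2 * u' n) := fun N =>
    hsum.of_nonneg_of_le (fun n => mul_nonneg (sq_nonneg _) (sq_nonneg _))
      (fun n => mul_le_of_le_one_left (sq_nonneg _) (by
        have h0 := fejerWeight_nonneg N (n + 1)
        have h1 := fejerWeight_le_one N (n + 1)
        nlinarith))
  -- the exact formula for `∫ (G_N - f)²`
  have hexact : ∀ N, ∫ x, (fejerPoly N f x - f x) ^ 2 ∂haarAddCircle
      = 2 * ∑' n : ℕ, (1 - fejerWeight N (n + 1)) ^ 2 * u' n := by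
    intro N
    have hpt : ∀ x, (fejerPoly N f x - f x) ^ 2
        = fejerPoly N f x ^ 2 - 2 * (fejerPoly N f x * f x) + f x ^ 2 := fun x => by ring
    simp_rw [hpt]
    have e1 : ∫ x, (fejerPoly N f x ^ 2 - 2 * (fejerPoly N f x * f x) + f x ^ 2) ∂haarAddCircle
        = (∫ x, (fejerPoly N f x ^ 2 - 2 * (fejerPoly N f x * f x)) ∂haarAddCircle)
          + ∫ x, f x ^ 2 ∂haarAddCircle :=
      integral_add (f := fun x => fejerPoly N f x ^ 2 - 2 * (fejerPoly N f x * f x))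
        (g := fun x => f x ^ 2) ((hG2 N).sub ((hGfI N).const_mul 2)) hf2I
    have e2 : ∫ x, (fejerPoly N f x ^ 2 - 2 * (fejerPoly N f x * f x)) ∂haarAddCircle
        = (∫ x, fejerPoly N f x ^ 2 ∂haarAddCircle)
          - ∫ x, 2 * (fejerPoly N f x * f x) ∂haarAddCircle :=
      integral_sub (f := fun x => fejerPoly N f x ^ 2)
        (g := fun x => 2 * (fejerPoly N f x * f x)) (hG2 N) ((hGfI N).const_mul 2)
    rw [e1, e2, integral_const_mul, hGG, hGf, hff]
    have hsplit : ∑' n : ℕ, (1 - fejerWeight N (n + 1)) ^ 2 * u' n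
        = ∑' n : ℕ, u' n - 2 * ∑' n : ℕ, fejerWeight N (n + 1) * u' n
          + ∑' n : ℕ, fejerWeight N (n + 1) ^ 2 * u' n := by
      rw [← tsum_mul_left, ← (hsum).tsum_sub ((hsw N).mul_left 2),
        ← Summable.tsum_add (hsum.sub ((hsw N).mul_left 2)) (hsw2 N)]
      refine tsum_congr fun n => ?_
      ring
    rw [hsplit]
    ring
  simp_rw [hexact]
  have hc : Continuous (fun w : ℝ => (1 - w) ^ 2) := by fun_prop
  have h := tendsto_tsum_fejerWeight hf (fun w => (1 - w) ^ 2)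
    (fun w h0 h1 => by rw [abs_of_nonneg (sq_nonneg _)]; nlinarith) 0
    (by simpa using hc.tendsto (1 : ℝ))
  simp only [zero_mul, tsum_zero] at h
  have h2 := h.const_mul 2
  rw [mul_zero] at h2
  exact h2

end Limits

end CircleLogSobolev

end Literature.Analysis.FunctionSpaces

namespace Literature.Analysis.FunctionSpaces

namespace CircleLogSobolev

/-! ## 8. Positive and negative parts of `x² log x`; assembly (Fatou and dominated convergence) -/

section Assembly

open Filter Topology

variable {T : ℝ} [hT : Fact (0 < T)]

/-- The positive part `(x² log x)⁺`. [folklore] -/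
def psiPos (x : ℝ) : ℝ := max (x ^ 2 * Real.log x) 0

/-- The negative part `(x² log x)⁻`. [folklore] -/
def psiNeg (x : ℝ) : ℝ := max (-(x ^ 2 * Real.log x)) 0

omit hT in
/-- `(x² log x)⁺` is continuous. [folklore] -/
theorem continuous_psiPos : Continuous psiPos :=
  continuous_sq_mul_log.max continuous_const

omit hT in
/-- `(x² log x)⁻` is continuous. [folklore] -/
theorem continuous_psiNeg : Continuous psiNeg :=
  continuous_sq_mul_log.neg.max continuous_const

omit hT in
/-- `0 ≤ (x² log x)⁺`. [folklore] -/
theorem psiPos_nonneg (x : ℝ) : 0 ≤ psiPos x := le_max_right _ _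

omit hT in
/-- `0 ≤ (x² log x)⁻`. [folklore] -/
theorem psiNeg_nonneg (x : ℝ) : 0 ≤ psiNeg x := le_max_right _ _

omit hT in
/-- `x² log x = (x² log x)⁺ - (x² log x)⁻`. [folklore] -/
theorem psiPos_sub_psiNeg (x : ℝ) : psiPos x - psiNeg x = x ^ 2 * Real.log x := by
  unfold psiPos psiNeg
  rcases le_total 0 (x ^ 2 * Real.log x) with h | h
  · rw [max_eq_left h, max_eq_right (by linarith)]; ring
  · rw [max_eq_right h, max_eq_left (by linarith)]; ring

omit hT in
/-- `(x² log x)⁻ ≤ 1` for `x ≥ 0` (`-log x ≤ 1/x - 1`, so `-x² log x ≤ x - x² ≤ 1`). [folklore] -/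
theorem psiNeg_le_one {x : ℝ} (hx : 0 ≤ x) : psiNeg x ≤ 1 := by
  unfold psiNeg
  refine max_le ?_ zero_le_one
  rcases hx.eq_or_lt with h | h
  · rw [← h]; simp
  · have h1 := Real.one_sub_inv_le_log_of_pos h
    have h2 : -(x ^ 2 * Real.log x) ≤ x ^ 2 * (x⁻¹ - 1) := by nlinarith [sq_nonneg x]
    have h3 : x ^ 2 * (x⁻¹ - 1) = x - x ^ 2 := by field_simp
    nlinarith [sq_nonneg (x - 1 / 2)]

/-- Continuous functions on the circle are in `L²(dθ/T)`. [folklore] -/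
theorem memLp_two_of_continuous_haar {g : AddCircle T → ℝ} (hg : Continuous g) :
    MemLp g 2 (haarAddCircle (T := T)) :=
  (memLp_two_iff_integrable_sq hg.aestronglyMeasurable).mpr
    (integrable_of_continuous_haar (hg.pow 2))

/-- `‖h‖_{L²} = (∫ h²)^{1/2}` as an `ℝ≥0∞` identity, for `h ∈ L²`. [folklore] -/
theorem eLpNorm_two_eq_ofReal {h : AddCircle T → ℝ} (hh : MemLp h 2 (haarAddCircle (T := T))) :
    eLpNorm h 2 haarAddCircle
      = ENNReal.ofReal ((∫ x, h x ^ 2 ∂haarAddCircle) ^ (2 : ℝ)⁻¹) := by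
  rw [hh.eLpNorm_eq_integral_rpow_norm two_ne_zero ENNReal.ofNat_ne_top]
  simp only [ENNReal.toReal_ofNat, Real.rpow_two, Real.norm_eq_abs, sq_abs]

/-- The Fejér polynomials of a non-negative function are non-negative. [cite: Katznelson2004, Ch. I §2.5] -/
theorem fejerPoly_nonneg (N : ℕ) {f : AddCircle T → ℝ} (hf0 : ∀ y, 0 ≤ f y)
    (hf : Integrable f haarAddCircle) (x : AddCircle T) : 0 ≤ fejerPoly N f x := by
  rw [fejerPoly, ← fejerMean_eq_realTrigPoly N hf x]
  exact fejerMean_nonneg N hf0 x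

/-- **(1.1) for the Fejér polynomials of `f`**, with the right-hand side already bounded by the
data of `f`: `∫ (σ_N f)² log σ_N f ≤ ∑ₙ |n| |f̂(n)|² + m_N log √m_N`, `m_N = ‖σ_N f‖₂²`.
[cite: Weissler1980, §1 Thm 1 (1.12)] -/
theorem integral_fejerPoly_sq_mul_log_le (N : ℕ) {f : AddCircle T → ℝ} (hf0 : ∀ y, 0 ≤ f y)
    (hf : Integrable f haarAddCircle)
    (hS : Summable (fun n : ℤ => |(n : ℝ)| * ‖fourierCoeff (fun y => (f y : ℂ)) n‖ ^ 2)) :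
    ∫ x, fejerPoly N f x ^ 2 * Real.log (fejerPoly N f x) ∂haarAddCircle
      ≤ (∑' n : ℤ, |(n : ℝ)| * ‖fourierCoeff (fun y => (f y : ℂ)) n‖ ^ 2)
        + ((fourierCoeff (fun y => (f y : ℂ)) 0).re ^ 2 + 2 * ∑ d ∈ Icc 1 N, ‖fejerCoeff N f d‖ ^ 2)
          * Real.log (Real.sqrt ((fourierCoeff (fun y => (f y : ℂ)) 0).re ^ 2
            + 2 * ∑ d ∈ Icc 1 N, ‖fejerCoeff N f d‖ ^ 2)) := by
  have h := logSobolev_realTrigPoly (T := T) N (fourierCoeff (fun y => (f y : ℂ)) 0).re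
    (fejerCoeff N f) (fejerPoly_nonneg N hf0 hf)
  have h2 : 2 * ∑ k ∈ Icc 1 N, (k : ℝ) * ‖fejerCoeff N f k‖ ^ 2
      ≤ ∑' n : ℤ, |(n : ℝ)| * ‖fourierCoeff (fun y => (f y : ℂ)) n‖ ^ 2 := by
    refine le_trans ?_ (two_mul_sum_le_tsum_abs_mul f N hS)
    gcongr with k hk
    rw [norm_fejerCoeff]
    exact mul_le_of_le_one_left (norm_nonneg _) (fejerWeight_le_one _ _)
  exact h.trans (by linarith)

end Assembly

end CircleLogSobolev

open CircleLogSobolev Filter Topology in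
/-- **Weissler's logarithmic Sobolev inequality on the circle** ([Weissler1980], §1 Thm 1,
(1.1)): `∫ f² log f ≤ ∑ₙ |n| |aₙ|² + ‖f‖₂² log ‖f‖₂` for `f ≥ 0` in `L²(dθ/T)` with
`∑ₙ |n| |aₙ|² < ∞`. Proof: the inequality for the (non-negative) Fejér polynomials `σ_N f`
(`CircleLogSobolev.integral_fejerPoly_sq_mul_log_le`, from Jensen + moment identities +
Cauchy–Schwarz), `‖σ_N f‖₂ → ‖f‖₂` and `σ_N f → f` in `L²` (Parseval + Tannery), an a.e.
convergent subsequence, Fatou's lemma for `(x² log x)⁺` and dominated convergence for the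
bounded `(x² log x)⁻` — the approximate-identity/Fatou step of the printed proof.
[cite: Weissler1980, §1 Thm 1 (1.1)] -/
theorem Weissler1980_circle_logSobolev_holds : Weissler1980_circle_logSobolev := by
  intro T hT f hf0 hf2 hS
  have hf1 : Integrable f haarAddCircle := hf2.integrable one_le_two
  set S : ℝ := ∑' n : ℤ, |(n : ℝ)| * ‖fourierCoeff (fun θ => (f θ : ℂ)) n‖ ^ 2 with hSdef
  set m : ℝ := ∫ θ, f θ ^ 2 ∂haarAddCircle with hmdef
  have hm0 : 0 ≤ m := integral_nonneg fun θ => sq_nonneg _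
  -- the Fejér polynomials `G N = σ_N f`
  set G : ℕ → AddCircle T → ℝ := fun N => fejerPoly N f with hGdef
  have hGc : ∀ N, Continuous (G N) := fun N => continuous_realTrigPoly _ _ _
  have hG0 : ∀ N x, 0 ≤ G N x := fun N x => fejerPoly_nonneg N hf0 hf1 x
  set mN : ℕ → ℝ := fun N => (fourierCoeff (fun θ => (f θ : ℂ)) 0).re ^ 2
    + 2 * ∑ d ∈ Icc 1 N, ‖fejerCoeff N f d‖ ^ 2 with hmNdef
  have hmN0 : ∀ N, 0 ≤ mN N := fun N => by positivity
  have hmN : Tendsto mN atTop (𝓝 m) := tendsto_sqNorm_fejer hf2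
  -- (1.12): the inequality for `σ_N f`
  have h112 : ∀ N, ∫ x, G N x ^ 2 * Real.log (G N x) ∂haarAddCircle
      ≤ S + mN N * Real.log (Real.sqrt (mN N)) :=
    fun N => integral_fejerPoly_sq_mul_log_le N hf0 hf1 hS
  -- `σ_N f → f` in `L²`, hence in measure, hence a.e. along a subsequence
  have hL2 : Tendsto (fun N => ∫ x, (G N x - f x) ^ 2 ∂haarAddCircle) atTop (𝓝 0) :=
    tendsto_integral_sq_fejerPoly_sub hf2
  have hmeas : TendstoInMeasure haarAddCircle G atTop f := by
    refine tendstoInMeasure_of_tendsto_eLpNorm (p := 2) two_ne_zero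
      (fun N => (hGc N).aestronglyMeasurable) hf2.1 ?_
    have hmem : ∀ N, MemLp (G N - f) 2 haarAddCircle :=
      fun N => (memLp_two_of_continuous_haar (hGc N)).sub hf2
    have heq : ∀ N, eLpNorm (G N - f) 2 haarAddCircle
        = ENNReal.ofReal ((∫ x, (G N x - f x) ^ 2 ∂haarAddCircle) ^ (2 : ℝ)⁻¹) :=
      fun N => eLpNorm_two_eq_ofReal (hmem N)
    simp_rw [heq]
    have h1 : Tendsto (fun N => (∫ x, (G N x - f x) ^ 2 ∂haarAddCircle) ^ (2 : ℝ)⁻¹) atTop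
        (𝓝 0) := by
      have := hL2.rpow_const (p := (2 : ℝ)⁻¹) (Or.inr (by norm_num))
      rwa [Real.zero_rpow (by norm_num)] at this
    rw [← ENNReal.ofReal_zero]
    exact ENNReal.tendsto_ofReal h1
  obtain ⟨ns, hns, hae⟩ := hmeas.exists_seq_tendsto_ae
  -- dominated convergence for the bounded negative parts
  have hnegI : ∀ N, Integrable (fun x => psiNeg (G N x)) haarAddCircle :=
    fun N => integrable_of_continuous_haar (continuous_psiNeg.comp (hGc N))
  have hnegIf : Integrable (fun x => psiNeg (f x)) haarAddCircle :=
    Integrable.of_bound (continuous_psiNeg.comp_aestronglyMeasurable hf2.1) 1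
      (ae_of_all _ fun x => by
        rw [Real.norm_of_nonneg (psiNeg_nonneg _)]
        exact psiNeg_le_one (hf0 x))
  have hneg : Tendsto (fun k => ∫ x, psiNeg (G (ns k) x) ∂haarAddCircle) atTop
      (𝓝 (∫ x, psiNeg (f x) ∂haarAddCircle)) := by
    refine tendsto_integral_of_dominated_convergence (fun _ => (1 : ℝ))
      (fun k => (continuous_psiNeg.comp (hGc _)).aestronglyMeasurable) (integrable_const 1)
      (fun k => ae_of_all _ fun x => ?_) ?_
    · rw [Real.norm_of_nonneg (psiNeg_nonneg _)]
      exact psiNeg_le_one (hG0 _ x)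
    · filter_upwards [hae] with x hx
      exact (continuous_psiNeg.tendsto _).comp hx
  -- the real bound for the positive parts along the subsequence
  have hposI : ∀ N, Integrable (fun x => psiPos (G N x)) haarAddCircle :=
    fun N => integrable_of_continuous_haar (continuous_psiPos.comp (hGc N))
  have hR : ∀ k, ∫ x, psiPos (G (ns k) x) ∂haarAddCircle
      ≤ S + mN (ns k) * Real.log (Real.sqrt (mN (ns k)))
        + ∫ x, psiNeg (G (ns k) x) ∂haarAddCircle := by
    intro k
    have hsplit : ∫ x, psiPos (G (ns k) x) ∂haarAddCircle
        = (∫ x, G (ns k) x ^ 2 * Real.log (G (ns k) x) ∂haarAddCircle)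
          + ∫ x, psiNeg (G (ns k) x) ∂haarAddCircle := by
      have hI : Integrable (fun x => G (ns k) x ^ 2 * Real.log (G (ns k) x)) haarAddCircle :=
        integrable_of_continuous_haar (continuous_sq_mul_log.comp (hGc _))
      rw [← integral_add hI (hnegI (ns k))]
      refine integral_congr_ae (ae_of_all _ fun x => ?_)
      have := psiPos_sub_psiNeg (G (ns k) x)
      linarith
    rw [hsplit]
    linarith [h112 (ns k)]
  -- its limit
  set B : ℝ := S + m * Real.log (Real.sqrt m) + ∫ x, psiNeg (f x) ∂haarAddCircle with hBdef
  have hRlim : Tendsto (fun k => S + mN (ns k) * Real.log (Real.sqrt (mN (ns k)))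
      + ∫ x, psiNeg (G (ns k) x) ∂haarAddCircle) atTop (𝓝 B) := by
    refine (tendsto_const_nhds.add ?_).add hneg
    have hmN' : Tendsto (fun k => mN (ns k)) atTop (𝓝 m) := hmN.comp hns.tendsto_atTop
    have key : ∀ y : ℝ, 0 ≤ y → y * Real.log (Real.sqrt y) = y * Real.log y / 2 := by
      intro y hy
      rw [Real.log_sqrt hy]
      ring
    have h2 : Tendsto (fun k => mN (ns k) * Real.log (mN (ns k)) / 2) atTop
        (𝓝 (m * Real.log m / 2)) :=
      ((Real.continuous_mul_log.tendsto m).comp hmN').div_const 2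
    rw [key m hm0]
    exact h2.congr fun k => (key _ (hmN0 _)).symm
  have hB0 : 0 ≤ B :=
    ge_of_tendsto' hRlim fun k => (integral_nonneg fun x => psiPos_nonneg _).trans (hR k)
  -- Fatou for the positive parts
  have hFatou : ∫⁻ x, ENNReal.ofReal (psiPos (f x)) ∂haarAddCircle ≤ ENNReal.ofReal B := by
    have h1 : ∀ᵐ x ∂haarAddCircle, ENNReal.ofReal (psiPos (f x))
        = liminf (fun k => ENNReal.ofReal (psiPos (G (ns k) x))) atTop := by
      filter_upwards [hae] with x hx
      exact ((ENNReal.continuous_ofReal.tendsto _).comp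
        ((continuous_psiPos.tendsto _).comp hx)).liminf_eq.symm
    rw [lintegral_congr_ae h1]
    refine (lintegral_liminf_le' fun k => ?_).trans ?_
    · exact (ENNReal.measurable_ofReal.comp
        (continuous_psiPos.measurable.comp (hGc _).measurable)).aemeasurable
    have h3 : ∀ k, ∫⁻ x, ENNReal.ofReal (psiPos (G (ns k) x)) ∂haarAddCircle
        ≤ ENNReal.ofReal (S + mN (ns k) * Real.log (Real.sqrt (mN (ns k)))
          + ∫ x, psiNeg (G (ns k) x) ∂haarAddCircle) := by
      intro k
      rw [← ofReal_integral_eq_lintegral_ofReal (hposI _) (ae_of_all _ fun x => psiPos_nonneg _)]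
      exact ENNReal.ofReal_le_ofReal (hR k)
    calc liminf (fun k => ∫⁻ x, ENNReal.ofReal (psiPos (G (ns k) x)) ∂haarAddCircle) atTop
        ≤ liminf (fun k => ENNReal.ofReal (S + mN (ns k) * Real.log (Real.sqrt (mN (ns k)))
          + ∫ x, psiNeg (G (ns k) x) ∂haarAddCircle)) atTop :=
          liminf_le_liminf (Eventually.of_forall h3)
      _ = ENNReal.ofReal B := (ENNReal.tendsto_ofReal hRlim).liminf_eq
  -- hence the positive part of `f² log f` is integrable, with the right bound
  have hposIf : Integrable (fun x => psiPos (f x)) haarAddCircle := by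
    refine ⟨continuous_psiPos.comp_aestronglyMeasurable hf2.1, ?_⟩
    rw [hasFiniteIntegral_iff_ofReal (ae_of_all _ fun x => psiPos_nonneg (f x))]
    exact hFatou.trans_lt ENNReal.ofReal_lt_top
  have hposle : ∫ x, psiPos (f x) ∂haarAddCircle ≤ B := by
    rw [integral_eq_lintegral_of_nonneg_ae (ae_of_all _ fun x => psiPos_nonneg (f x))
      (continuous_psiPos.comp_aestronglyMeasurable hf2.1)]
    exact ENNReal.toReal_le_of_le_ofReal hB0 hFatou
  -- conclusion
  have hdec : ∫ θ, f θ ^ 2 * Real.log (f θ) ∂haarAddCircle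
      = (∫ x, psiPos (f x) ∂haarAddCircle) - ∫ x, psiNeg (f x) ∂haarAddCircle := by
    rw [← integral_sub hposIf hnegIf]
    refine integral_congr_ae (ae_of_all _ fun x => ?_)
    exact (psiPos_sub_psiNeg (f x)).symm
  rw [hdec]
  linarith

end Literature.Analysis.FunctionSpaces
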